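import Literature.MathematicalPhysics.QuantumFieldTheory.BalabanImbrieJaffe1984to88.BIJ88Eq5613DeltaLoc
import Literature.MathematicalPhysics.QuantumFieldTheory.BalabanImbrieJaffe1984to88.BIJ88Eq5613KineticSources
import Literature.MathematicalPhysics.QuantumFieldTheory.BalabanImbrieJaffe1984to88.BIJ88Eq5612W6

/-!
# `BalabanImbrieJaffe1984to88.BIJ88Eq5613Total` — T. Bałaban, J. Imbrie, A. Jaffe, *Effective action and cluster properties of the
abelian Higgs model*, Commun. Math. Phys. **114** (1988) 257–315 [BalabanImbrieJaffe1988], §5.6 p. 288 [PDF 32]: **the whole cube term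
`W₁^{(k)}(□)` of (5.6.13) and the bound `|W₁^{(k)}(□)| ≦ e_k^{n̄−1−α}`** — ASSEMBLY of the bookkeeping (`BIJ88Eq5613Summary`), the
kinetic term with its (5.4.7)-fed sources (`BIJ88Eq5613Kinetic`, `BIJ88Eq5613KineticSources`), the `Δ_{k,loc}` term at kernel level
(`BIJ88Eq5613DeltaLoc`) completed here by ITS sources (phase factors on `φ`, `w₁`-phases on the transporters and the `w₁`-shift of
the propagator) and by the localization difference `δR = R̃^{(k)} − R^{(k)}` (*"replacing propagators G_k(□,ũ_{k+1}) with
G_{k,loc}(ũ_{k+1}) and eliminating extra kernels ζ″_k"* — the `R̃` of the DIFFERENCE kernel family, bounded by the `w₆`-type size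
of the companion (5.6.12) files), and the `𝒫_{k,loc}` term under DISPLAYED derivative bounds (p. 275: *"𝒫_{k,loc} … given by a
perturbation expansion up to some fixed order n̄, which we describe in detail in a later paper"*)

statement-level skeleton of published theorems with citation tags; proofs where landed; nothing here is a claim about the Yang–Mills mass gap

PDF held: `paper:balaban1988-cmp114-bij-abelian-higgs-effective-action` (journal page = PDF page + 256); p. 288 [PDF 32] read as an
image this session (r16's render), pp. 287, 282, 275, 263 likewise.

CITATION HEADER (lean-in-tree rule).  Part of the lit-balaban TYPED SKELETON (HOME `run/shared/lean/pub/lit-balaban/`), PHASE-2 proof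
seat p31 gen 11 (unit `lit-balaban-p31-g11`).  WHAT IS REPRODUCED: row `C2.Eq5.6.13` of `HOME/lit-balaban-r16/ROWS-C2-part2.md`
(owner r16), the OWNER'S FLIP CONDITION (b) of ROWS-C2-part2 v2.74, verbatim in substance: *"«|W₁^{(k)}(□)| ≤ e_k^{n̄−1−α}» PROVED for
THAT W₁ summand by summand — kinetic + Δ_{k,loc} at operator level, the 𝒫_{k,loc} summand under DISPLAYED derivative-bound hypotheses on
𝒫_{k,loc}, the w₁/w₂ sources fed BY NAME from row C2.Eq5.4.7 (`Ineq547` leaves), the localization difference from the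
(5.6.12)/w₆ files, small-field hypotheses |φ|, |A| ≤ p(e_k)-type displayed; constants generic"*.  Print, p. 288 [PDF 32]: *"… =
½aL⁻²⟨ψ − Q(ũ_{k+1})φ, ψ − Q(ũ_{k+1})φ⟩ + ½⟨Λ₈^{(k−1)′}φ, Δ_{k,loc}(ũ_{k+1})Λ₈^{(k−1)′}φ⟩ + 𝒫_{k,loc}(Λ₈^{(k−1)}, φ, ũ_{k+1}) +
R^{(k)}(u_{k+1}, θ_kH_{k,loc}A^{(k)}) + Σ_□W₁^{(k)}(□). (5.6.13) … Here W₁^{(k)}(□) is localized near □, an r(e_k)-cube in Λ₂^{(k)}, and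
|W₁^{(k)}(□)| ≦ e_k^{n̄−1−α}. (Two powers of e_k may be needed to beat the bounds on φ.)"*

WHAT IS PROVED (0 `sorry`, standard axioms; definitions with bodies + theorems, no `Prop` facts).
* §1 tools: `Rtilde_sub` (linearity of `R̃`), `abs_Rtilde_le` (`|R̃| ≤ Σ_{n<n̄}|F^{(n+1)}(0)|/(n+1)!`); `sand_sub_v`/`sand_sub_G`
  (linearity of the `Δ_{k,loc}` sandwich in the field and in the propagator), `norm_sand_le` (`‖(QGQ^*u)(x)‖ ≤ V_c(u)·γ`),
  `col_weight_phase`, `norm_sand_twist_sub_le` (the `w₁`-phases on both block averages move the sandwich by `≤ 2δ′V_cγ`); the bridge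
  to the (5.6.12)/`w₆` files `rowSum_le_of_norm_le` (their `ℓ^∞`-operator norm dominates the row sums used here) and `rowSum_w6_le`
  (`BIJ88Eq5612W6.norm_w6_matrix_le` BY NAME: a `w₆`-kernel with `‖g₀v‖ ≤ θ ≤ 1`, `‖w′₆‖ ≤ ε` has row sums `≤ (N+1)ε`).
* §2 the complete `Δ_{k,loc}` site term: `dltPhys` (physical density: phases on `φ`, `w₁`-phases, propagator `G_p = G_{k,loc}(ũ_{k+1}ũ)`),
  `dltW`, `deltaR` (`:= R̃[G] − R̃[G′]`, the localization difference as data: `G′` = the simplified family), **`W1dltTot`** `:= W1 (S_phys)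
  (family with G) n̄ (δR)`, `eq5613_dltTot_site`, **`W1dltTot_eq_sources`**, the four piece bounds `abs_dltPhys_sub_dltW_le`,
  `abs_dltW_sub_dlt_one_le`, (`abs_W1dlt_le` of the companion), **`abs_deltaR_le`**, and **`abs_W1dltTot_le`**.
* §3 print's currency for the `Δ_{k,loc}` term: `currency_step`, the piece bounds `abs_dltPhys_sub_dltW_le_scale`,
  `abs_dltW_sub_dlt_one_le_scale`, `abs_deltaR_le_scale`, the constant `dltTotConst`, and **`abs_W1dltTot_le_scale`**
  (`≤ K·e_k^{n̄−1}p(e_k)^{n̄+3}` once `e^{−cr(e_k)} ≤ e_k^{n̄}`, regime `(2c_A + c_G)e_kp(e_k) ≤ 1`, `δ ≤ 1`, `p(e_k) ≥ 1`).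
* §4 the `𝒫_{k,loc}` site term under displayed hypotheses: `W1PTot`, `eq5613_PTot_site`, **`abs_W1PTot_le_scale`**.
* §5 the generic three-part assembly: `cubeSum₃`, `sum_cubeSum_of_superset`, `eq5613_three`, `abs_cubeSum₃_le`, `ineq5613_three`.
* §6 the instance of record: **`W1tot`** (kinetic cube term over the `ψ`-sites + `Δ_{k,loc}` and `𝒫_{k,loc}` cube terms over the
  `φ`-sites), **`eq5613_total`** ((5.6.13) for the full three-term action with the physical left sides; the `R`-bracket is
  `Σ_y R̃_kin(y) + Σ_x R̃[G′](x) + Σ_x (R̃_𝒫 − δR_𝒫)(x)`), and **`ineq5613_total`**: r16's leaf `BIJ88Sect5StatementsPart2.Ineq5613` for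
  `W₁ = W1tot …`, every running charge `0 < e_k ≤ min(e⁻¹, e₀)` with `(log e_k⁻¹)^{r−1} ≥ n̄/c` (so that `e^{−cr(e_k)} ≤ e_k^{n̄}`,
  `BIJ88Eq5613Summary.exp_neg_mul_rLen_le_rpow`), `e₀ = threshold (K_kin + K_Δ + K_𝒫) q α` explicit.
HONEST SCOPE.  Displayed (not derived): the `𝒫_{k,loc}` families and their derivative/source bounds (p. 275); the propagator
families `G` (true), `G′` (simplified) with their row-sum regularity `γ_m ≤ g·m!·C_Gᵐ`, `γ′`; the `w₁`-shift of the propagator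
`Σ_{z′}|G_p − G(1)| ≤ δ_G = O(e_ke^{−cr}p)` ((5.6.11) with the `w₁A′` insertion) and the localization difference `Σ|dᵐ(G−G′)(0)| ≤
δ_w·m!·C_Gᵐ`, `δ_w = O(e^{−cr})` (the `w₆`/`w′₆` sizes of p31 g10 `BIJ88W6PrimeSmall287.bound_le_exp`, `BIJ88Eq5612W6.norm_w6_le`; the
`e′`-derivative structure of `w₆(e′)` is displayed, its order-zero reading is `rowSum_w6_le`);
lattice sums, contour data, small-field radii, regime conditions — all as in the companions.  DERIVED by name from (5.4.7): the
phase-factor size `δ` and the `w₁`-phase size `δ′` (`BIJ88Eq5613KineticSources`).  Imports the companions; no Summits import; modifies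
nothing.  Unit `lit-balaban-p31` (literature-prover-lit-balaban-p31-g11-0), 2026-08-22.  NOT summit progress; NOT continuum; NOT Clay.
-/

noncomputable section

open Complex
open scoped BigOperators ComplexConjugate Matrix.Norms.Operator
open Set

namespace Literature.MathematicalPhysics.QuantumFieldTheory.BalabanImbrieJaffe1984to88.BIJ88Eq5613Total

open BIJ88TaylorSplit5614 (Rtilde Ftilde)
open BIJ88Eq5613Summary (W1 W1_eq_sources eq5613 cubeSum norm_cubeSum_le sum_eq_sum_cubeSum ineq5613_of_cube_bounds absorb_logs
  threshold pLog_eq_rpow rLen_eq_rpow one_le_log_inv log_rpow_le_log_rpow log_rpow_mul_log_rpow log_rpow_pow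
  le_one_of_le_exp_neg_one exp_neg_mul_rLen_le_rpow Rtilde_eq_sum_iteratedDeriv norm_Ftilde_le_of_contDiff)
open BIJ88Eq5613Kinetic (ephase twist kin norm_ephase norm_ephase_one_sub_one_le kinLogPower)
open BIJ88Eq5613KineticSources (kinPhys W1kinTot W1kinTotCube kinTotConst kinTotConst_nonneg abs_W1kinTotCube_le_scale
  eq5613_kinTot)
open BIJ88Eq5613DeltaLoc (sand dlt Gamma W1dlt sand_eq_sum₃ ephase_mul_conj contDiff_sand iteratedDeriv_sand contDiff_dlt
  iteratedDeriv_dlt_succ Gamma_nonneg Gamma_le_of_factorial norm_iteratedDeriv_sand_le abs_W1dlt_le)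
open BIJ88Sect5StatementsPart2 (Ineq5613)
open BIJ88Sect2Statements (pLog rLen)

/-! ## §1 Tools -/

section Tools

/-- kernel: `R̃` is linear — `R̃[F − H] = R̃[F] − R̃[H]` for smooth families. [cite: BalabanImbrieJaffe1988, (5.6.14) p.288] -/
theorem Rtilde_sub {F H : ℝ → ℝ} (hF : ∀ n : ℕ, ContDiff ℝ n F) (hH : ∀ n : ℕ, ContDiff ℝ n H) (nbar : ℕ) :
    Rtilde (fun t => F t - H t) nbar = Rtilde F nbar - Rtilde H nbar := by
  rw [Rtilde_eq_sum_iteratedDeriv (fun n => (hF n).sub (hH n)), Rtilde_eq_sum_iteratedDeriv hF,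
    Rtilde_eq_sum_iteratedDeriv hH, ← Finset.sum_sub_distrib]
  refine Finset.sum_congr rfl fun n _ => ?_
  rw [iteratedDeriv_fun_sub ((hF (n + 1)).contDiffAt) ((hH (n + 1)).contDiffAt), smul_sub]

/-- kernel: `|R̃[F]| ≤ Σ_{n<n̄} |F^{(n+1)}(0)|/(n+1)!`. [cite: BalabanImbrieJaffe1988, (5.6.14) p.288] -/
theorem abs_Rtilde_le {F : ℝ → ℝ} (hF : ∀ n : ℕ, ContDiff ℝ n F) (nbar : ℕ) :
    |Rtilde F nbar| ≤ ∑ n ∈ Finset.range nbar, |iteratedDeriv (n + 1) F 0| / (n + 1).factorial := by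
  rw [Rtilde_eq_sum_iteratedDeriv hF]
  refine (Finset.abs_sum_le_sum_abs _ _).trans (le_of_eq (Finset.sum_congr rfl fun n _ => ?_))
  rw [smul_eq_mul, abs_mul, abs_of_nonneg (by positivity), one_div, inv_mul_eq_div]

variable {α β : Type} [Fintype α] [DecidableEq α]
variable {B : β → Finset α} {w : ℝ} {U : β → α → ℂ} {A : β → α → ℝ} {Y : Finset β}

/-- kernel: the sandwich is linear in the field: `(QGQ^*v₁)(x) − (QGQ^*v₂)(x) = (QGQ^*(v₁ − v₂))(x)`.
[cite: BalabanImbrieJaffe1988, (2.34) p.263] -/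
theorem sand_sub_v (G : ℝ → α → α → ℂ) (v₁ v₂ : β → ℂ) (t : ℝ) (x : β) :
    sand B w U A G v₁ Y t x - sand B w U A G v₂ Y t x = sand B w U A G (fun y => v₁ y - v₂ y) Y t x := by
  simp only [sand, ← Finset.sum_sub_distrib, ← mul_sub]

/-- kernel: the sandwich is linear in the propagator: `(QG₁Q^*v)(x) − (QG₂Q^*v)(x) = (Q(G₁ − G₂)Q^*v)(x)`.
[cite: BalabanImbrieJaffe1988, (2.34) p.263] -/
theorem sand_sub_G (G₁ G₂ : ℝ → α → α → ℂ) (v : β → ℂ) (t : ℝ) (x : β) :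
    sand B w U A G₁ v Y t x - sand B w U A G₂ v Y t x = sand B w U A (fun t z z' => G₁ t z z' - G₂ t z z') v Y t x := by
  simp only [sand, ← Finset.sum_sub_distrib, ← mul_sub, ← sub_mul]

/-- kernel: **`‖(Q(e′)G(e′)Q(e′)^*u)(x)‖ ≤ V_c(u)·γ`** for unit transporters, row normalisation `|w||B(x)| ≤ 1`, column weight
`Σ_{y∈Y: z′∈B(y)}|w|‖u(y)‖ ≤ V_c` and propagator row sums `Σ_{z′}‖G(e′)(z,z′)‖ ≤ γ`. [cite: BalabanImbrieJaffe1988, (2.34) p.263] -/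
theorem norm_sand_le {G : ℝ → α → α → ℂ} {u : β → ℂ} {Vc γ : ℝ} (hVc : 0 ≤ Vc) (hγ : 0 ≤ γ)
    (hU : ∀ y z, z ∈ B y → ‖U y z‖ ≤ 1) (hw : ∀ x, |w| * (B x).card ≤ 1)
    (hcol : ∀ z', ∑ y ∈ Y.filter (fun y => z' ∈ B y), |w| * ‖u y‖ ≤ Vc) {t : ℝ}
    (hG : ∀ z, ∑ z', ‖G t z z'‖ ≤ γ) (x : β) : ‖sand B w U A G u Y t x‖ ≤ Vc * γ := by
  unfold sand
  have hin : ∀ z', ‖∑ y ∈ Y.filter (fun y => z' ∈ B y), conj ((w : ℂ) * U y z' * ephase (A y z') t) * u y‖ ≤ Vc := by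
    intro z'
    refine (norm_sum_le _ _).trans ((Finset.sum_le_sum fun y hy => ?_).trans (hcol z'))
    rw [Finset.mem_filter] at hy
    rw [norm_mul, Complex.norm_conj, norm_mul, norm_mul, Complex.norm_real, Real.norm_eq_abs, norm_ephase, mul_one]
    calc |w| * ‖U y z'‖ * ‖u y‖ ≤ |w| * 1 * ‖u y‖ := by gcongr; exact hU y z' hy.2
      _ = |w| * ‖u y‖ := by ring
  have hmid : ∀ z, ‖∑ z', G t z z' * ∑ y ∈ Y.filter (fun y => z' ∈ B y),
      conj ((w : ℂ) * U y z' * ephase (A y z') t) * u y‖ ≤ γ * Vc := by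
    intro z
    refine (norm_sum_le _ _).trans ?_
    calc ∑ z', ‖G t z z' * ∑ y ∈ Y.filter (fun y => z' ∈ B y), conj ((w : ℂ) * U y z' * ephase (A y z') t) * u y‖
        ≤ ∑ z', ‖G t z z'‖ * Vc := Finset.sum_le_sum fun z' _ => by
          rw [norm_mul]; exact mul_le_mul_of_nonneg_left (hin z') (norm_nonneg _)
      _ = (∑ z', ‖G t z z'‖) * Vc := by rw [Finset.sum_mul]
      _ ≤ γ * Vc := mul_le_mul_of_nonneg_right (hG z) hVc
  refine (norm_sum_le _ _).trans ?_
  calc ∑ z ∈ B x, ‖((w : ℂ) * U x z * ephase (A x z) t) * ∑ z', G t z z' *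
        ∑ y ∈ Y.filter (fun y => z' ∈ B y), conj ((w : ℂ) * U y z' * ephase (A y z') t) * u y‖
      ≤ ∑ z ∈ B x, |w| * ‖U x z‖ * (γ * Vc) := Finset.sum_le_sum fun z _ => by
        rw [norm_mul, norm_mul, norm_mul, Complex.norm_real, Real.norm_eq_abs, norm_ephase, mul_one]
        exact mul_le_mul_of_nonneg_left (hmid z) (by positivity)
    _ ≤ ∑ z ∈ B x, |w| * 1 * (γ * Vc) := Finset.sum_le_sum fun z hz => by gcongr; exact hU x z hz
    _ = |w| * (B x).card * (γ * Vc) := by rw [Finset.sum_const, nsmul_eq_mul]; ring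
    _ ≤ 1 * (γ * Vc) := mul_le_mul_of_nonneg_right (hw x) (by positivity)
    _ = Vc * γ := by ring

omit [Fintype α] in
/-- kernel: column weights under a phase factor on the field — `|P − 1| ≤ δ` on `Y` gives `V_c(v(P−1)) ≤ δV_c(v)` and
`V_c(vP) ≤ (1+δ)V_c(v)`. [cite: BalabanImbrieJaffe1988, (5.4.7) p.282] -/
theorem col_weight_phase {v : β → ℂ} {Pφ : β → ℂ} {δ Vc : ℝ} (hδ : 0 ≤ δ) (hP : ∀ y ∈ Y, ‖Pφ y - 1‖ ≤ δ)
    (hcol : ∀ z', ∑ y ∈ Y.filter (fun y => z' ∈ B y), |w| * ‖v y‖ ≤ Vc) (z' : α) :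
    ∑ y ∈ Y.filter (fun y => z' ∈ B y), |w| * ‖v y * Pφ y - v y‖ ≤ δ * Vc ∧
    ∑ y ∈ Y.filter (fun y => z' ∈ B y), |w| * ‖v y * Pφ y‖ ≤ (1 + δ) * Vc := by
  have h1 : ∑ y ∈ Y.filter (fun y => z' ∈ B y), |w| * ‖v y * Pφ y - v y‖ ≤ δ * Vc := by
    calc ∑ y ∈ Y.filter (fun y => z' ∈ B y), |w| * ‖v y * Pφ y - v y‖
        ≤ ∑ y ∈ Y.filter (fun y => z' ∈ B y), δ * (|w| * ‖v y‖) := Finset.sum_le_sum fun y hy => by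
          rw [Finset.mem_filter] at hy
          rw [← mul_sub_one, norm_mul]
          calc |w| * (‖v y‖ * ‖Pφ y - 1‖) ≤ |w| * (‖v y‖ * δ) := by gcongr; exact hP y hy.1
            _ = δ * (|w| * ‖v y‖) := by ring
      _ = δ * ∑ y ∈ Y.filter (fun y => z' ∈ B y), |w| * ‖v y‖ := by rw [Finset.mul_sum]
      _ ≤ δ * Vc := mul_le_mul_of_nonneg_left (hcol z') hδ
  refine ⟨h1, ?_⟩
  calc ∑ y ∈ Y.filter (fun y => z' ∈ B y), |w| * ‖v y * Pφ y‖
      ≤ ∑ y ∈ Y.filter (fun y => z' ∈ B y), (|w| * ‖v y‖ + |w| * ‖v y * Pφ y - v y‖) :=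
        Finset.sum_le_sum fun y _ => by
          rw [← mul_add]
          refine mul_le_mul_of_nonneg_left ?_ (abs_nonneg _)
          have := norm_add_le (v y) (v y * Pφ y - v y); rwa [add_sub_cancel] at this
    _ = ∑ y ∈ Y.filter (fun y => z' ∈ B y), |w| * ‖v y‖ + ∑ y ∈ Y.filter (fun y => z' ∈ B y), |w| * ‖v y * Pφ y - v y‖ :=
        Finset.sum_add_distrib
    _ ≤ Vc + δ * Vc := add_le_add (hcol z') h1
    _ = (1 + δ) * Vc := by ring

/-- kernel: **the `w₁`-phases on both block averages** move the sandwich by at most `2δ′·V_c·γ`: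
`‖(Q[Ue^{iA′}]GQ[Ue^{iA′}]^*v)(x) − (Q[U]GQ[U]^*v)(x)‖ ≤ 2δ′V_cγ` for `|A′| ≤ δ′` (unit `U`, row normalisation, column weight `V_c`,
propagator row sums `γ`). [cite: BalabanImbrieJaffe1988, (5.6.6) p.287] -/
theorem norm_sand_twist_sub_le {G : ℝ → α → α → ℂ} {v : β → ℂ} {A' : β → α → ℝ} {Vc γ δ' : ℝ} (hVc : 0 ≤ Vc) (hγ : 0 ≤ γ)
    (hδ' : 0 ≤ δ') (hU : ∀ y z, z ∈ B y → ‖U y z‖ ≤ 1) (hA' : ∀ y z, z ∈ B y → |A' y z| ≤ δ')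
    (hw : ∀ x, |w| * (B x).card ≤ 1) (hcol : ∀ z', ∑ y ∈ Y.filter (fun y => z' ∈ B y), |w| * ‖v y‖ ≤ Vc) {t : ℝ}
    (hG : ∀ z, ∑ z', ‖G t z z'‖ ≤ γ) (x : β) :
    ‖sand B w (twist U A' 1) A G v Y t x - sand B w U A G v Y t x‖ ≤ 2 * δ' * (Vc * γ) := by
  rw [sand_eq_sum₃, sand_eq_sum₃]
  simp only [← Finset.sum_sub_distrib]
  have hterm : ∀ z ∈ B x, ∀ z', ∀ y ∈ Y.filter (fun y => z' ∈ B y),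
      ‖(((w : ℂ) * twist U A' 1 x z) * conj ((w : ℂ) * twist U A' 1 y z') * v y) * (ephase (A x z - A y z') t * G t z z')
        - (((w : ℂ) * U x z) * conj ((w : ℂ) * U y z') * v y) * (ephase (A x z - A y z') t * G t z z')‖
      ≤ 2 * δ' * (|w| * ‖U x z‖ * (‖G t z z'‖ * (|w| * ‖v y‖))) := by
    intro z hz z' y hy
    rw [Finset.mem_filter] at hy
    have hid : (((w : ℂ) * twist U A' 1 x z) * conj ((w : ℂ) * twist U A' 1 y z') * v y) * (ephase (A x z - A y z') t * G t z z')
        - (((w : ℂ) * U x z) * conj ((w : ℂ) * U y z') * v y) * (ephase (A x z - A y z') t * G t z z')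
        = (((w : ℂ) * U x z) * conj ((w : ℂ) * U y z') * v y) * (ephase (A x z - A y z') t * G t z z')
          * (ephase (A' x z - A' y z') 1 - 1) := by
      simp only [twist, ← ephase_mul_conj, map_mul]; ring
    rw [hid, norm_mul, norm_mul, norm_mul, norm_mul, norm_mul, norm_mul, Complex.norm_real, Real.norm_eq_abs, Complex.norm_conj,
      norm_mul, Complex.norm_real, Real.norm_eq_abs, norm_ephase, one_mul]
    have hph : ‖ephase (A' x z - A' y z') 1 - 1‖ ≤ 2 * δ' := by
      refine (norm_ephase_one_sub_one_le _).trans ?_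
      calc |A' x z - A' y z'| ≤ |A' x z| + |A' y z'| := abs_sub _ _
        _ ≤ δ' + δ' := add_le_add (hA' x z hz) (hA' y z' hy.2)
        _ = 2 * δ' := by ring
    have hUy : ‖U y z'‖ ≤ 1 := hU y z' hy.2
    calc |w| * ‖U x z‖ * (|w| * ‖U y z'‖) * ‖v y‖ * ‖G t z z'‖ * ‖ephase (A' x z - A' y z') 1 - 1‖
        ≤ |w| * ‖U x z‖ * (|w| * 1) * ‖v y‖ * ‖G t z z'‖ * (2 * δ') := by gcongr
      _ = 2 * δ' * (|w| * ‖U x z‖ * (‖G t z z'‖ * (|w| * ‖v y‖))) := by ring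
  have hz : ∀ z ∈ B x, ‖∑ z', ∑ y ∈ Y.filter (fun y => z' ∈ B y),
      ((((w : ℂ) * twist U A' 1 x z) * conj ((w : ℂ) * twist U A' 1 y z') * v y) * (ephase (A x z - A y z') t * G t z z')
        - (((w : ℂ) * U x z) * conj ((w : ℂ) * U y z') * v y) * (ephase (A x z - A y z') t * G t z z'))‖
      ≤ 2 * δ' * (|w| * ‖U x z‖ * (γ * Vc)) := by
    intro z hz
    refine (norm_sum_le _ _).trans ?_
    calc ∑ z', ‖∑ y ∈ Y.filter (fun y => z' ∈ B y),
          ((((w : ℂ) * twist U A' 1 x z) * conj ((w : ℂ) * twist U A' 1 y z') * v y) * (ephase (A x z - A y z') t * G t z z')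
            - (((w : ℂ) * U x z) * conj ((w : ℂ) * U y z') * v y) * (ephase (A x z - A y z') t * G t z z'))‖
        ≤ ∑ z', 2 * δ' * (|w| * ‖U x z‖ * (‖G t z z'‖ * Vc)) := Finset.sum_le_sum fun z' _ => by
          refine (norm_sum_le _ _).trans ((Finset.sum_le_sum fun y hy => hterm z hz z' y hy).trans ?_)
          rw [← Finset.mul_sum, ← Finset.mul_sum, ← Finset.mul_sum]
          gcongr
          exact hcol z'
      _ = 2 * δ' * (|w| * ‖U x z‖ * ((∑ z', ‖G t z z'‖) * Vc)) := by
          rw [← Finset.mul_sum, ← Finset.mul_sum, Finset.sum_mul]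
      _ ≤ 2 * δ' * (|w| * ‖U x z‖ * (γ * Vc)) := by gcongr; exact hG z
  refine (norm_sum_le _ _).trans ((Finset.sum_le_sum hz).trans ?_)
  calc ∑ z ∈ B x, 2 * δ' * (|w| * ‖U x z‖ * (γ * Vc))
      = 2 * δ' * ((∑ z ∈ B x, |w| * ‖U x z‖) * (γ * Vc)) := by rw [← Finset.mul_sum, Finset.sum_mul]
    _ ≤ 2 * δ' * (1 * (γ * Vc)) := by
        gcongr
        calc ∑ z ∈ B x, |w| * ‖U x z‖ ≤ ∑ z ∈ B x, |w| * 1 :=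
              Finset.sum_le_sum fun z hz => mul_le_mul_of_nonneg_left (hU x z hz) (abs_nonneg _)
          _ = |w| * (B x).card := by rw [Finset.sum_const, nsmul_eq_mul]; ring
          _ ≤ 1 := hw x
    _ = 2 * δ' * (Vc * γ) := by ring

/-- kernel: **row sums from the kernel norm** — the `ℓ^∞`-operator norm of the (5.6.12)/`w₆` files (`BIJ88Eq5612W6.norm_eq_rowSum`:
`‖K‖ = sup_{z}Σ_{z′}|K(z,z′)|`) dominates every row sum, which is the form of the propagator hypotheses of this file and of
`BIJ88Eq5613DeltaLoc`. [cite: BalabanImbrieJaffe1988, (5.6.12) p.288] -/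
theorem rowSum_le_of_norm_le {K : Matrix α α ℂ} {γ : ℝ} (h : ‖K‖ ≤ γ) (z : α) : ∑ z', ‖K z z'‖ ≤ γ := by
  refine le_trans ?_ h
  rw [Matrix.linfty_opNorm_def]
  have h1 : ∑ z', ‖K z z'‖ = ((∑ z', ‖K z z'‖₊ : NNReal) : ℝ) := by push_cast; rfl
  rw [h1]
  exact_mod_cast Finset.le_sup (f := fun x₁ => ∑ x₂, ‖K x₁ x₂‖₊) (Finset.mem_univ z)

/-- **The localization input fed from the (5.6.12)/`w₆` files**: when a member of the difference family `G − G′` (at some order in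
`e′`) IS a `w₆`-kernel `w₆ = Σ_{n≤N}(g₀v)ⁿw′₆` of (5.6.12) with `‖g₀v‖ ≤ θ ≤ 1` and `‖w′₆‖ ≤ ε` (`ε = O(e^{−cr(e_j)})` by p31 g10
`BIJ88W6PrimeSmall287`), its row sums are `≤ (N+1)ε` — `BIJ88Eq5612W6.norm_w6_matrix_le` read through `rowSum_le_of_norm_le`.
[cite: BalabanImbrieJaffe1988, (5.6.12) p.288] -/
theorem rowSum_w6_le {g₀ vK w' : Matrix α α ℂ} {θ ε : ℝ} (hθ : ‖g₀ * vK‖ ≤ θ) (hθ1 : θ ≤ 1) (hε : ‖w'‖ ≤ ε) (N : ℕ)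
    (z : α) : ∑ z', ‖BIJ88Eq5612W6.w6 g₀ vK w' N z z'‖ ≤ (N + 1) * ε := by
  have hθ0 : 0 ≤ θ := (norm_nonneg _).trans hθ
  refine rowSum_le_of_norm_le ((BIJ88Eq5612W6.norm_w6_matrix_le hθ N).trans ?_) z
  have hgeom : ∑ n ∈ Finset.range (N + 1), θ ^ n ≤ N + 1 :=
    calc ∑ n ∈ Finset.range (N + 1), θ ^ n ≤ ∑ n ∈ Finset.range (N + 1), (1 : ℝ) :=
          Finset.sum_le_sum fun n _ => pow_le_one₀ hθ0 hθ1
      _ = N + 1 := by simp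
  exact mul_le_mul hgeom hε (norm_nonneg _) (by positivity)

end Tools

/-! ## §2 The complete `Δ_{k,loc}` site term -/

section DeltaSite

variable {α β : Type} [Fintype α] [DecidableEq α]

/-- **The physical `Δ_{k,loc}` density** `½⟨Λ₈′φ̃, Δ_{k,loc}(ũ_{k+1}ũ)Λ₈′φ̃⟩` at the coarse site `x` — left side of (5.6.13): phase
factors on the field (`ṽ = vP_φ`), `w₁`-phases on the transporters (`Ue^{iA′}`, then `e^{iA}` at `e′ = 1`), propagator
`G_p = G_{k,loc}(ũ_{k+1}ũ)` (a fixed kernel). [cite: BalabanImbrieJaffe1988, (5.6.13) p.288] -/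
def dltPhys (a : ℝ) (B : β → Finset α) (w : ℝ) (U : β → α → ℂ) (A A' : β → α → ℝ) (Pφ : β → ℂ) (Gp : α → α → ℂ)
    (v : β → ℂ) (Y : Finset β) (x : β) : ℝ :=
  dlt a B w (twist U A' 1) A (fun _ => Gp) (fun y => v y * Pφ y) Y 1 x

/-- The same density WITHOUT the phase factors on the field. [cite: BalabanImbrieJaffe1988, (5.6.13) p.288] -/
def dltW (a : ℝ) (B : β → Finset α) (w : ℝ) (U : β → α → ℂ) (A A' : β → α → ℝ) (Gp : α → α → ℂ) (v : β → ℂ)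
    (Y : Finset β) (x : β) : ℝ :=
  dlt a B w (twist U A' 1) A (fun _ => Gp) v Y 1 x

/-- **The localization difference `δR(x) = R̃^{(k)}(x) − R^{(k)}(x)`** of (5.6.13)/(5.6.14) for the `Δ_{k,loc}` term: `R̃` of the
density with the propagator family `G` minus `R̃` of the density with the simplified family `G′` (*"R^{(k)} can be obtained by replacing
propagators G_k(□, ũ_{k+1}) with G_{k,loc}(ũ_{k+1}) and eliminating extra kernels ζ″_k"*). [cite: BalabanImbrieJaffe1988, (5.6.14) p.288] -/
def deltaR (a : ℝ) (B : β → Finset α) (w : ℝ) (U : β → α → ℂ) (A : β → α → ℝ) (G G' : ℝ → α → α → ℂ) (v : β → ℂ)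
    (Y : Finset β) (nbar : ℕ) (x : β) : ℝ :=
  Rtilde (fun t => dlt a B w U A G v Y t x) nbar - Rtilde (fun t => dlt a B w U A G' v Y t x) nbar

/-- **The complete `Δ_{k,loc}` site term `W₁,Δ,tot(x)`** of (5.6.13): the bookkeeping `W1` of `BIJ88Eq5613Summary` for the physical
density, the interpolation family with the propagator family `G`, and the localization `δR(x)`. [cite: BalabanImbrieJaffe1988, (5.6.13) p.288] -/
def W1dltTot (a : ℝ) (B : β → Finset α) (w : ℝ) (U : β → α → ℂ) (A A' : β → α → ℝ) (Pφ : β → ℂ) (Gp : α → α → ℂ)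
    (G G' : ℝ → α → α → ℂ) (v : β → ℂ) (Y : Finset β) (nbar : ℕ) (x : β) : ℝ :=
  W1 (dltPhys a B w U A A' Pφ Gp v Y x) (fun t => dlt a B w U A G v Y t x) nbar (deltaR a B w U A G G' v Y nbar x)

/-- **(5.6.13), `Δ_{k,loc}` term, physical left side**: `S_phys,Δ(x) = d_x(0) + R_Δ(x) + W₁,Δ,tot(x)` with `R_Δ(x) = R̃[G](x) − δR(x)
= R̃[G′](x)` (the simplified `R^{(k)}`). [cite: BalabanImbrieJaffe1988, (5.6.13) p.288] -/
theorem eq5613_dltTot_site (a : ℝ) (B : β → Finset α) (w : ℝ) (U : β → α → ℂ) (A A' : β → α → ℝ) (Pφ : β → ℂ)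
    (Gp : α → α → ℂ) (G G' : ℝ → α → α → ℂ) (v : β → ℂ) (Y : Finset β) (nbar : ℕ) (x : β) :
    dltPhys a B w U A A' Pφ Gp v Y x
      = dlt a B w U A G v Y 0 x + Rtilde (fun t => dlt a B w U A G' v Y t x) nbar
        + W1dltTot a B w U A A' Pφ Gp G G' v Y nbar x := by
  simp only [W1dltTot, deltaR, W1]
  ring

/-- **The four pieces**: `W₁,Δ,tot(x) = (S_phys − S_w) + (S_w − d_x(1)) + W₁,Δ(x) + δR(x)`.
[cite: BalabanImbrieJaffe1988, (5.6.13) p.288] -/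
theorem W1dltTot_eq_sources (a : ℝ) (B : β → Finset α) (w : ℝ) (U : β → α → ℂ) (A A' : β → α → ℝ) (Pφ : β → ℂ)
    (Gp : α → α → ℂ) (G G' : ℝ → α → α → ℂ) (v : β → ℂ) (Y : Finset β) (nbar : ℕ) (x : β) :
    W1dltTot a B w U A A' Pφ Gp G G' v Y nbar x
      = (dltPhys a B w U A A' Pφ Gp v Y x - dltW a B w U A A' Gp v Y x)
        + (dltW a B w U A A' Gp v Y x - dlt a B w U A G v Y 1 x) + W1dlt a B w U A G v Y nbar x
        + deltaR a B w U A G G' v Y nbar x := by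
  rw [W1dltTot, W1_eq_sources _ (dltW a B w U A A' Gp v Y x)]
  rfl

variable {a : ℝ} {B : β → Finset α} {w : ℝ} {U : β → α → ℂ} {A A' : β → α → ℝ} {Pφ : β → ℂ} {Gp : α → α → ℂ}
  {G G' : ℝ → α → α → ℂ} {v : β → ℂ} {Y : Finset β}

/-- **The phase-factor source of the `Δ_{k,loc}` term**: `|S_phys,Δ(x) − S_w,Δ(x)| ≤ ½|a|δ(2+δ)‖v(x)‖² + ½a²δ(2+δ)‖v(x)‖V_cγ_p` for
`|P_φ − 1| ≤ δ`, unit transporters, row normalisation, column weight `V_c`, propagator row sums `γ_p`.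
[cite: BalabanImbrieJaffe1988, (5.6.13) p.288] -/
theorem abs_dltPhys_sub_dltW_le {δ Vc γp : ℝ} (hδ : 0 ≤ δ) (hVc : 0 ≤ Vc) (hγp : 0 ≤ γp)
    (hU : ∀ y z, z ∈ B y → ‖U y z‖ ≤ 1) (hw : ∀ x, |w| * (B x).card ≤ 1)
    (hcol : ∀ z', ∑ y ∈ Y.filter (fun y => z' ∈ B y), |w| * ‖v y‖ ≤ Vc) (hP : ∀ y, ‖Pφ y - 1‖ ≤ δ)
    (hGp : ∀ z, ∑ z', ‖Gp z z'‖ ≤ γp) (x : β) :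
    |dltPhys a B w U A A' Pφ Gp v Y x - dltW a B w U A A' Gp v Y x|
      ≤ (1 / 2) * |a| * (δ * (2 + δ) * ‖v x‖ ^ 2) + (1 / 2) * a ^ 2 * (δ * (2 + δ) * ‖v x‖ * (Vc * γp)) := by
  have hU' : ∀ y z, z ∈ B y → ‖twist U A' 1 y z‖ ≤ 1 := fun y z hz => by
    simp only [twist, norm_mul, norm_ephase, mul_one]; exact hU y z hz
  -- sizes
  have hvx : ‖v x * Pφ x - v x‖ ≤ δ * ‖v x‖ := by
    rw [← mul_sub_one, norm_mul, mul_comm]; exact mul_le_mul_of_nonneg_right (hP x) (norm_nonneg _)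
  have hvPx : ‖v x * Pφ x‖ ≤ (1 + δ) * ‖v x‖ := by
    have := norm_add_le (v x) (v x * Pφ x - v x); rw [add_sub_cancel] at this; linarith
  have hc := col_weight_phase (B := B) (w := w) (Y := Y) (v := v) hδ (fun y _ => hP y) hcol
  have hS1 : ‖sand B w (twist U A' 1) A (fun _ => Gp) (fun y => v y * Pφ y) Y 1 x‖ ≤ (1 + δ) * Vc * γp :=
    norm_sand_le (by positivity) hγp hU' hw (fun z' => (hc z').2) (fun z => hGp z) x
  have hS2 : ‖sand B w (twist U A' 1) A (fun _ => Gp) (fun y => v y * Pφ y) Y 1 x - sand B w (twist U A' 1) A (fun _ => Gp) v Y 1 x‖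
      ≤ δ * Vc * γp := by
    rw [sand_sub_v]
    exact norm_sand_le (by positivity) hγp hU' hw (fun z' => (hc z').1) (fun z => hGp z) x
  have hsq : |‖v x * Pφ x‖ ^ 2 - ‖v x‖ ^ 2| ≤ δ * (2 + δ) * ‖v x‖ ^ 2 := by
    refine (BIJ88Eq5613Kinetic.abs_normSq_sub_normSq_le (v x * Pφ x) (v x)).trans ?_
    calc (‖v x * Pφ x‖ + ‖v x‖) * ‖v x * Pφ x - v x‖ ≤ ((1 + δ) * ‖v x‖ + ‖v x‖) * (δ * ‖v x‖) :=
          mul_le_mul (by linarith) hvx (norm_nonneg _) (by positivity)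
      _ = δ * (2 + δ) * ‖v x‖ ^ 2 := by ring
  have hre : |(conj (v x * Pφ x) * sand B w (twist U A' 1) A (fun _ => Gp) (fun y => v y * Pφ y) Y 1 x).re
      - (conj (v x) * sand B w (twist U A' 1) A (fun _ => Gp) v Y 1 x).re| ≤ δ * (2 + δ) * ‖v x‖ * (Vc * γp) := by
    rw [← Complex.sub_re]
    refine (Complex.abs_re_le_norm _).trans ?_
    have hid : conj (v x * Pφ x) * sand B w (twist U A' 1) A (fun _ => Gp) (fun y => v y * Pφ y) Y 1 x
        - conj (v x) * sand B w (twist U A' 1) A (fun _ => Gp) v Y 1 x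
        = (conj (v x * Pφ x) - conj (v x)) * sand B w (twist U A' 1) A (fun _ => Gp) (fun y => v y * Pφ y) Y 1 x
          + conj (v x) * (sand B w (twist U A' 1) A (fun _ => Gp) (fun y => v y * Pφ y) Y 1 x
            - sand B w (twist U A' 1) A (fun _ => Gp) v Y 1 x) := by
      ring
    rw [hid]
    refine (norm_add_le _ _).trans ?_
    rw [norm_mul, norm_mul, ← map_sub, Complex.norm_conj, Complex.norm_conj]
    calc ‖v x * Pφ x - v x‖ * ‖sand B w (twist U A' 1) A (fun _ => Gp) (fun y => v y * Pφ y) Y 1 x‖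
          + ‖v x‖ * ‖sand B w (twist U A' 1) A (fun _ => Gp) (fun y => v y * Pφ y) Y 1 x
            - sand B w (twist U A' 1) A (fun _ => Gp) v Y 1 x‖
        ≤ (δ * ‖v x‖) * ((1 + δ) * Vc * γp) + ‖v x‖ * (δ * Vc * γp) :=
          add_le_add (mul_le_mul hvx hS1 (norm_nonneg _) (by positivity)) (mul_le_mul_of_nonneg_left hS2 (norm_nonneg _))
      _ = δ * (2 + δ) * ‖v x‖ * (Vc * γp) := by ring
  unfold dltPhys dltW dlt
  have hid2 : (1 / 2) * (a * ‖v x * Pφ x‖ ^ 2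
        - a ^ 2 * (conj (v x * Pφ x) * sand B w (twist U A' 1) A (fun _ => Gp) (fun y => v y * Pφ y) Y 1 x).re)
      - (1 / 2) * (a * ‖v x‖ ^ 2 - a ^ 2 * (conj (v x) * sand B w (twist U A' 1) A (fun _ => Gp) v Y 1 x).re)
      = (1 / 2) * a * (‖v x * Pφ x‖ ^ 2 - ‖v x‖ ^ 2)
        - (1 / 2) * a ^ 2 * ((conj (v x * Pφ x) * sand B w (twist U A' 1) A (fun _ => Gp) (fun y => v y * Pφ y) Y 1 x).re
          - (conj (v x) * sand B w (twist U A' 1) A (fun _ => Gp) v Y 1 x).re) := by ring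
  rw [hid2]
  refine (abs_sub _ _).trans ?_
  rw [abs_mul, abs_mul, abs_mul, abs_mul, abs_of_nonneg (by norm_num : (0 : ℝ) ≤ 1 / 2), abs_of_nonneg (sq_nonneg a)]
  exact add_le_add (mul_le_mul_of_nonneg_left hsq (by positivity)) (mul_le_mul_of_nonneg_left hre (by positivity))

/-- **The `w₁` source of the `Δ_{k,loc}` term**: `|S_w,Δ(x) − d_x(1)| ≤ ½a²‖v(x)‖(2δ′V_cγ₁ + V_cδ_G)` — the `w₁`-phases on the two block
averages (`|A′| ≤ δ′`, row sums `γ₁` of `G(1)`) and the `w₁`-shift of the propagator (`Σ_{z′}|G_p − G(1)| ≤ δ_G`).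
[cite: BalabanImbrieJaffe1988, (5.6.13) p.288] -/
theorem abs_dltW_sub_dlt_one_le {δ' δG Vc γ₁ : ℝ} (hδ' : 0 ≤ δ') (hVc : 0 ≤ Vc) (hγ₁ : 0 ≤ γ₁) (hδG : 0 ≤ δG)
    (hU : ∀ y z, z ∈ B y → ‖U y z‖ ≤ 1) (hA' : ∀ y z, z ∈ B y → |A' y z| ≤ δ') (hw : ∀ x, |w| * (B x).card ≤ 1)
    (hcol : ∀ z', ∑ y ∈ Y.filter (fun y => z' ∈ B y), |w| * ‖v y‖ ≤ Vc) (hG1 : ∀ z, ∑ z', ‖G 1 z z'‖ ≤ γ₁)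
    (hGd : ∀ z, ∑ z', ‖Gp z z' - G 1 z z'‖ ≤ δG) (x : β) :
    |dltW a B w U A A' Gp v Y x - dlt a B w U A G v Y 1 x| ≤ (1 / 2) * a ^ 2 * (‖v x‖ * (2 * δ' * (Vc * γ₁) + Vc * δG)) := by
  have hU' : ∀ y z, z ∈ B y → ‖twist U A' 1 y z‖ ≤ 1 := fun y z hz => by
    simp only [twist, norm_mul, norm_ephase, mul_one]; exact hU y z hz
  have hS1 : ‖sand B w (twist U A' 1) A (fun _ => Gp) v Y 1 x - sand B w (twist U A' 1) A G v Y 1 x‖ ≤ Vc * δG := by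
    rw [sand_sub_G]
    exact norm_sand_le hVc hδG hU' hw hcol (fun z => hGd z) x
  have hS2 : ‖sand B w (twist U A' 1) A G v Y 1 x - sand B w U A G v Y 1 x‖ ≤ 2 * δ' * (Vc * γ₁) :=
    norm_sand_twist_sub_le hVc hγ₁ hδ' hU hA' hw hcol (fun z => hG1 z) x
  unfold dltW dlt
  have hid : (1 / 2) * (a * ‖v x‖ ^ 2 - a ^ 2 * (conj (v x) * sand B w (twist U A' 1) A (fun _ => Gp) v Y 1 x).re)
      - (1 / 2) * (a * ‖v x‖ ^ 2 - a ^ 2 * (conj (v x) * sand B w U A G v Y 1 x).re)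
      = -((1 / 2) * a ^ 2) * (conj (v x) * (sand B w (twist U A' 1) A (fun _ => Gp) v Y 1 x - sand B w U A G v Y 1 x)).re := by
    simp only [mul_sub, Complex.sub_re]; ring
  rw [hid, abs_mul, abs_neg, abs_of_nonneg (by positivity : (0 : ℝ) ≤ (1 / 2) * a ^ 2)]
  refine mul_le_mul_of_nonneg_left ((Complex.abs_re_le_norm _).trans ?_) (by positivity)
  rw [norm_mul, Complex.norm_conj]
  refine mul_le_mul_of_nonneg_left ?_ (norm_nonneg _)
  have hsplit : sand B w (twist U A' 1) A (fun _ => Gp) v Y 1 x - sand B w U A G v Y 1 x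
      = (sand B w (twist U A' 1) A G v Y 1 x - sand B w U A G v Y 1 x)
        + (sand B w (twist U A' 1) A (fun _ => Gp) v Y 1 x - sand B w (twist U A' 1) A G v Y 1 x) := by ring
  rw [hsplit]
  exact (norm_add_le _ _).trans (add_le_add hS2 hS1)

/-- **The localization difference**: `|δR(x)| ≤ ½a²‖v(x)‖V_c·Σ_{n=1}^{n̄}Γ_n(γ^d)/n!`, `Γ_n(γ^d)` the combinatorial bound of the companion
for the DIFFERENCE kernel family `G − G′` with row sums `Σ|dᵐ(G−G′)/de′ᵐ|(0) ≤ γ^d_m`. [cite: BalabanImbrieJaffe1988, (5.6.14) p.288] -/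
theorem abs_deltaR_le {A₀ Vc : ℝ} {γd : ℕ → ℝ} (hA₀ : 0 ≤ A₀) (hVc : 0 ≤ Vc) (hγd : ∀ m, 0 ≤ γd m)
    (hG : ∀ z z', ∀ n : ℕ, ContDiff ℝ n (fun t => G t z z')) (hG' : ∀ z z', ∀ n : ℕ, ContDiff ℝ n (fun t => G' t z z'))
    (hU : ∀ y z, z ∈ B y → ‖U y z‖ ≤ 1) (hA : ∀ y z, z ∈ B y → |A y z| ≤ A₀) (hw : ∀ x, |w| * (B x).card ≤ 1)
    (hcol : ∀ z', ∑ y ∈ Y.filter (fun y => z' ∈ B y), |w| * ‖v y‖ ≤ Vc) (nbar : ℕ)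
    (hγdG : ∀ m ≤ nbar, ∀ z, ∑ z', ‖iteratedDeriv m (fun s => G s z z' - G' s z z') 0‖ ≤ γd m) (x : β) :
    |deltaR a B w U A G G' v Y nbar x|
      ≤ (1 / 2) * a ^ 2 * ‖v x‖ * Vc * ∑ n ∈ Finset.range nbar, Gamma A₀ γd (n + 1) / (n + 1).factorial := by
  have hGd : ∀ z z', ∀ n : ℕ, ContDiff ℝ n (fun t => G t z z' - G' t z z') := fun z z' n => (hG z z' n).sub (hG' z z' n)
  have hdiff : (fun t => dlt a B w U A G v Y t x - dlt a B w U A G' v Y t x)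
      = fun t => dlt a B w U A (fun t z z' => G t z z' - G' t z z') v Y t x - (1 / 2) * a * ‖v x‖ ^ 2 := by
    funext t
    simp only [dlt]
    rw [← sand_sub_G]
    rw [mul_sub (conj (v x)), Complex.sub_re]
    ring
  unfold deltaR
  rw [← Rtilde_sub (fun n => contDiff_dlt B w U A v Y a hG x) (fun n => contDiff_dlt B w U A v Y a hG' x), hdiff,
    Rtilde_sub (fun n => contDiff_dlt B w U A v Y a hGd x) (fun n => contDiff_const), BIJ88Eq5613Summary.Rtilde_const, sub_zero]
  refine (abs_Rtilde_le (fun n => contDiff_dlt B w U A v Y a hGd x) nbar).trans ?_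
  rw [Finset.mul_sum]
  refine Finset.sum_le_sum fun n hn => ?_
  rw [Finset.mem_range] at hn
  have hb := BIJ88Eq5613DeltaLoc.abs_iteratedDeriv_dlt_le a hA₀ hVc hγd hGd hU hA hw hcol (n := n) (t := 0) (by simp)
    (fun m hm z => hγdG m (by omega) z) x
  calc |iteratedDeriv (n + 1) (fun t => dlt a B w U A (fun t z z' => G t z z' - G' t z z') v Y t x) 0| / (n + 1).factorial
      ≤ (1 / 2) * a ^ 2 * ‖v x‖ * (Vc * Gamma A₀ γd (n + 1)) / (n + 1).factorial :=
        div_le_div_of_nonneg_right hb (Nat.cast_nonneg _)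
    _ = (1 / 2) * a ^ 2 * ‖v x‖ * Vc * (Gamma A₀ γd (n + 1) / (n + 1).factorial) := by ring

/-- **The bound of the complete `Δ_{k,loc}` site term** (the four pieces). [cite: BalabanImbrieJaffe1988, (5.6.13) p.288] -/
theorem abs_W1dltTot_le {δ δ' δG Vc γp γ₁ A₀ : ℝ} {γ γd : ℕ → ℝ} (hδ : 0 ≤ δ) (hδ' : 0 ≤ δ') (hδG : 0 ≤ δG) (hVc : 0 ≤ Vc)
    (hγp : 0 ≤ γp) (hγ₁ : 0 ≤ γ₁) (hA₀ : 0 ≤ A₀) (hγ0 : ∀ m, 0 ≤ γ m) (hγd : ∀ m, 0 ≤ γd m)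
    (hG : ∀ z z', ∀ n : ℕ, ContDiff ℝ n (fun t => G t z z')) (hG' : ∀ z z', ∀ n : ℕ, ContDiff ℝ n (fun t => G' t z z'))
    (hU : ∀ y z, z ∈ B y → ‖U y z‖ ≤ 1) (hA : ∀ y z, z ∈ B y → |A y z| ≤ A₀) (hA' : ∀ y z, z ∈ B y → |A' y z| ≤ δ')
    (hw : ∀ x, |w| * (B x).card ≤ 1) (hcol : ∀ z', ∑ y ∈ Y.filter (fun y => z' ∈ B y), |w| * ‖v y‖ ≤ Vc)
    (hP : ∀ y, ‖Pφ y - 1‖ ≤ δ) (hGp : ∀ z, ∑ z', ‖Gp z z'‖ ≤ γp) (hG1 : ∀ z, ∑ z', ‖G 1 z z'‖ ≤ γ₁)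
    (hGpd : ∀ z, ∑ z', ‖Gp z z' - G 1 z z'‖ ≤ δG) (nbar : ℕ)
    (hγG : ∀ t ∈ Set.Icc (0 : ℝ) 1, ∀ m ≤ nbar + 1, ∀ z, ∑ z', ‖iteratedDeriv m (fun s => G s z z') t‖ ≤ γ m)
    (hγdG : ∀ m ≤ nbar, ∀ z, ∑ z', ‖iteratedDeriv m (fun s => G s z z' - G' s z z') 0‖ ≤ γd m) (x : β) :
    |W1dltTot a B w U A A' Pφ Gp G G' v Y nbar x|
      ≤ ((1 / 2) * |a| * (δ * (2 + δ) * ‖v x‖ ^ 2) + (1 / 2) * a ^ 2 * (δ * (2 + δ) * ‖v x‖ * (Vc * γp)))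
        + (1 / 2) * a ^ 2 * (‖v x‖ * (2 * δ' * (Vc * γ₁) + Vc * δG))
        + (1 / 2) * a ^ 2 * ‖v x‖ * (Vc * Gamma A₀ γ (nbar + 1)) / nbar.factorial
        + (1 / 2) * a ^ 2 * ‖v x‖ * Vc * ∑ n ∈ Finset.range nbar, Gamma A₀ γd (n + 1) / (n + 1).factorial := by
  rw [W1dltTot_eq_sources]
  have h1 := abs_dltPhys_sub_dltW_le (a := a) (A := A) (A' := A') hδ hVc hγp hU hw hcol hP hGp x
  have h2 := abs_dltW_sub_dlt_one_le (a := a) (A := A) hδ' hVc hγ₁ hδG hU hA' hw hcol hG1 hGpd x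
  have h3 := abs_W1dlt_le a hA₀ hVc hγ0 hG hU hA hw hcol nbar hγG x
  have h4 := abs_deltaR_le (a := a) hA₀ hVc hγd hG hG' hU hA hw hcol nbar hγdG x
  calc _ ≤ |dltPhys a B w U A A' Pφ Gp v Y x - dltW a B w U A A' Gp v Y x|
        + |dltW a B w U A A' Gp v Y x - dlt a B w U A G v Y 1 x| + |W1dlt a B w U A G v Y nbar x|
        + |deltaR a B w U A G G' v Y nbar x| :=
        (abs_add_le _ _).trans (add_le_add ((abs_add_le _ _).trans (add_le_add (abs_add_le _ _) le_rfl)) le_rfl)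
    _ ≤ _ := add_le_add (add_le_add (add_le_add h1 h2) h3) h4

end DeltaSite

/-! ## §3 Print's currency for the `Δ_{k,loc}` term -/

section DeltaScale

variable {α β : Type} [Fintype α] [DecidableEq α]
variable {a : ℝ} {B : β → Finset α} {w : ℝ} {U : β → α → ℂ} {A A' : β → α → ℝ} {Pφ : β → ℂ} {Gp : α → α → ℂ}
  {G G' : ℝ → α → α → ℂ} {v : β → ℂ} {Y : Finset β}

/-- The constant of the complete `Δ_{k,loc}` bound (phase source + `w₁` source + Taylor + localization).
[cite: BalabanImbrieJaffe1988, (5.6.13) p.288] -/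
def dltTotConst (a g cA cG cΦ S₁ S₂ ca cΓ cdG cw : ℝ) (nbar : ℕ) : ℝ :=
  3 * |a| * S₂ * ca * cΦ ^ 2 + 3 * a ^ 2 * S₂ * ca * cΦ ^ 2 * g + (1 / 2) * a ^ 2 * cΦ ^ 2 * (2 * cΓ * S₁ * ca * g + cdG)
    + BIJ88Eq5613DeltaLoc.dltConst a g cA cG cΦ nbar + (1 / 2) * a ^ 2 * cΦ ^ 2 * (2 * cA + cG) * cw * nbar

/-- kernel: `K ≥ 0`. [cite: BalabanImbrieJaffe1988, (5.6.13) p.288] -/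
theorem dltTotConst_nonneg {a g cA cG cΦ S₁ S₂ ca cΓ cdG cw : ℝ} (hg : 0 ≤ g) (hcA : 0 ≤ cA) (hcG : 0 ≤ cG) (hS₁ : 0 ≤ S₁)
    (hS₂ : 0 ≤ S₂) (hca : 0 ≤ ca) (hcΓ : 0 ≤ cΓ) (hcdG : 0 ≤ cdG) (hcw : 0 ≤ cw) (nbar : ℕ) :
    0 ≤ dltTotConst a g cA cG cΦ S₁ S₂ ca cΓ cdG cw nbar := by
  unfold dltTotConst
  have := BIJ88Eq5613DeltaLoc.dltConst_nonneg (a := a) (cΦ := cΦ) hg hcA hcG nbar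
  positivity

/-- kernel: the currency step — `c·(E/e)·pʲ ≤ c·e^{n̄−1}·p^{n̄+3}` for `E ≤ e^{n̄}`, `p ≥ 1`, `j ≤ n̄ + 3`.
[cite: BalabanImbrieJaffe1988, (5.6.13) p.288] -/
theorem currency_step {e E P c : ℝ} {nbar j : ℕ} (he : 0 < e) (hp1 : 1 ≤ P) (hEe : E ≤ e ^ (nbar : ℝ)) (hc : 0 ≤ c)
    (hj : j ≤ nbar + 3) : c * (E / e) * P ^ j ≤ c * e ^ ((nbar : ℝ) - 1) * P ^ (nbar + 3) := by
  have henn : 0 ≤ e ^ ((nbar : ℝ) - 1) := Real.rpow_nonneg he.le _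
  have hpow2 : E / e ≤ e ^ ((nbar : ℝ) - 1) := by
    rw [div_le_iff₀ he, Real.rpow_sub he, Real.rpow_one, div_mul_cancel₀ _ he.ne']; exact hEe
  calc c * (E / e) * P ^ j ≤ c * e ^ ((nbar : ℝ) - 1) * P ^ j :=
        mul_le_mul_of_nonneg_right (mul_le_mul_of_nonneg_left hpow2 hc) (pow_nonneg (zero_le_one.trans hp1) j)
    _ ≤ _ := mul_le_mul_of_nonneg_left (pow_le_pow_right₀ hp1 hj) (mul_nonneg hc henn)

/-- **Piece 1 in print's currency** (phase-factor source): with `δ ≤ 2eES₂(c_ap)`, `δ ≤ 1`, `‖v(x)‖, V_c ≤ Φ`, `eΦ ≤ c_Φp`, `γ_p ≤ g`,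
`E ≤ e^{n̄}`, `p ≥ 1`. [cite: BalabanImbrieJaffe1988, (5.6.13) p.288] -/
theorem abs_dltPhys_sub_dltW_le_scale {e p g cΦ S₂ ca Vc Φ γp δ E : ℝ} {nbar : ℕ} (he : 0 < e) (hp1 : 1 ≤ pLog p e)
    (hg : 0 ≤ g) (hcΦ : 0 ≤ cΦ) (hS₂ : 0 ≤ S₂) (hca : 0 ≤ ca) (hVc : 0 ≤ Vc) (hγp : 0 ≤ γp) (hδ0 : 0 ≤ δ)
    (hδ1 : δ ≤ 1) (hE0 : 0 ≤ E) (hEe : E ≤ e ^ (nbar : ℝ)) (hγpg : γp ≤ g) (hVcΦ : Vc ≤ Φ) (hΦ : e * Φ ≤ cΦ * pLog p e)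
    (hδ : δ ≤ 2 * e * E * S₂ * (ca * pLog p e)) (hU : ∀ y z, z ∈ B y → ‖U y z‖ ≤ 1) (hw : ∀ x, |w| * (B x).card ≤ 1)
    (hcol : ∀ z', ∑ y ∈ Y.filter (fun y => z' ∈ B y), |w| * ‖v y‖ ≤ Vc) (hPφ : ∀ y, ‖Pφ y - 1‖ ≤ δ)
    (hGp : ∀ z, ∑ z', ‖Gp z z'‖ ≤ γp) {x : β} (hvx : ‖v x‖ ≤ Φ) :
    |dltPhys a B w U A A' Pφ Gp v Y x - dltW a B w U A A' Gp v Y x|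
      ≤ (3 * |a| * S₂ * ca * cΦ ^ 2 + 3 * a ^ 2 * S₂ * ca * cΦ ^ 2 * g) * e ^ ((nbar : ℝ) - 1) * pLog p e ^ (nbar + 3) := by
  set P := pLog p e with hPdef
  have hP : 0 ≤ P := zero_le_one.trans hp1
  have hΦ' : Φ ≤ cΦ * P / e := by rw [le_div_iff₀ he, mul_comm]; exact hΦ
  have hv' : ‖v x‖ ≤ cΦ * P / e := hvx.trans hΦ'
  have hVc' : Vc ≤ cΦ * P / e := hVcΦ.trans hΦ'
  have hδ3 : δ * (2 + δ) ≤ 6 * e * E * S₂ * (ca * P) :=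
    calc δ * (2 + δ) ≤ δ * 3 := mul_le_mul_of_nonneg_left (by linarith) hδ0
      _ ≤ (2 * e * E * S₂ * (ca * P)) * 3 := mul_le_mul_of_nonneg_right hδ (by norm_num)
      _ = 6 * e * E * S₂ * (ca * P) := by ring
  refine (abs_dltPhys_sub_dltW_le (a := a) (A := A) (A' := A') hδ0 hVc hγp hU hw hcol hPφ hGp x).trans ?_
  have t1 : (1 / 2) * |a| * (δ * (2 + δ) * ‖v x‖ ^ 2) ≤ 3 * |a| * S₂ * ca * cΦ ^ 2 * (E / e) * P ^ 3 := by
    calc (1 / 2) * |a| * (δ * (2 + δ) * ‖v x‖ ^ 2) ≤ (1 / 2) * |a| * ((6 * e * E * S₂ * (ca * P)) * (cΦ * P / e) ^ 2) := by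
          refine mul_le_mul_of_nonneg_left ?_ (by positivity)
          exact mul_le_mul hδ3 (pow_le_pow_left₀ (norm_nonneg _) hv' 2) (sq_nonneg _) (by positivity)
      _ = 3 * |a| * S₂ * ca * cΦ ^ 2 * (E / e) * P ^ 3 := by field_simp; ring
  have t2 : (1 / 2) * a ^ 2 * (δ * (2 + δ) * ‖v x‖ * (Vc * γp)) ≤ 3 * a ^ 2 * S₂ * ca * cΦ ^ 2 * g * (E / e) * P ^ 3 := by
    calc (1 / 2) * a ^ 2 * (δ * (2 + δ) * ‖v x‖ * (Vc * γp))
        ≤ (1 / 2) * a ^ 2 * ((6 * e * E * S₂ * (ca * P)) * (cΦ * P / e) * ((cΦ * P / e) * g)) := by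
          refine mul_le_mul_of_nonneg_left ?_ (by positivity)
          exact mul_le_mul (mul_le_mul hδ3 hv' (norm_nonneg _) (by positivity)) (mul_le_mul hVc' hγpg hγp (by positivity))
            (by positivity) (by positivity)
      _ = 3 * a ^ 2 * S₂ * ca * cΦ ^ 2 * g * (E / e) * P ^ 3 := by field_simp; ring
  calc _ ≤ 3 * |a| * S₂ * ca * cΦ ^ 2 * (E / e) * P ^ 3 + 3 * a ^ 2 * S₂ * ca * cΦ ^ 2 * g * (E / e) * P ^ 3 := add_le_add t1 t2
    _ ≤ 3 * |a| * S₂ * ca * cΦ ^ 2 * e ^ ((nbar : ℝ) - 1) * P ^ (nbar + 3)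
        + 3 * a ^ 2 * S₂ * ca * cΦ ^ 2 * g * e ^ ((nbar : ℝ) - 1) * P ^ (nbar + 3) :=
        add_le_add (currency_step he hp1 hEe (by positivity) (by omega)) (currency_step he hp1 hEe (by positivity) (by omega))
    _ = _ := by ring

/-- **Piece 2 in print's currency** (`w₁` source): with `δ′ ≤ c_ΓeES₁(c_ap)`, the displayed `w₁`-shift `δ_G ≤ c_dG·e·E·p` ((5.6.11)
with the `w₁A′` insertion: one charge, one field factor), `γ₁ ≤ g`. [cite: BalabanImbrieJaffe1988, (5.6.13) p.288] -/
theorem abs_dltW_sub_dlt_one_le_scale {e p g cΦ S₁ ca cΓ cdG Vc Φ γ₁ δ' δG E : ℝ} {nbar : ℕ} (he : 0 < e)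
    (hp1 : 1 ≤ pLog p e) (hg : 0 ≤ g) (hcΦ : 0 ≤ cΦ) (hS₁ : 0 ≤ S₁) (hca : 0 ≤ ca) (hcΓ : 0 ≤ cΓ) (hcdG : 0 ≤ cdG)
    (hVc : 0 ≤ Vc) (hγ₁ : 0 ≤ γ₁) (hδ'0 : 0 ≤ δ') (hδG0 : 0 ≤ δG) (hE0 : 0 ≤ E) (hEe : E ≤ e ^ (nbar : ℝ))
    (hγ₁g : γ₁ ≤ g) (hVcΦ : Vc ≤ Φ) (hΦ : e * Φ ≤ cΦ * pLog p e) (hδ' : δ' ≤ cΓ * e * E * S₁ * (ca * pLog p e))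
    (hδG : δG ≤ cdG * e * E * pLog p e) (hU : ∀ y z, z ∈ B y → ‖U y z‖ ≤ 1) (hA' : ∀ y z, z ∈ B y → |A' y z| ≤ δ')
    (hw : ∀ x, |w| * (B x).card ≤ 1) (hcol : ∀ z', ∑ y ∈ Y.filter (fun y => z' ∈ B y), |w| * ‖v y‖ ≤ Vc)
    (hG1 : ∀ z, ∑ z', ‖G 1 z z'‖ ≤ γ₁) (hGpd : ∀ z, ∑ z', ‖Gp z z' - G 1 z z'‖ ≤ δG) {x : β} (hvx : ‖v x‖ ≤ Φ) :
    |dltW a B w U A A' Gp v Y x - dlt a B w U A G v Y 1 x|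
      ≤ (1 / 2) * a ^ 2 * cΦ ^ 2 * (2 * cΓ * S₁ * ca * g + cdG) * e ^ ((nbar : ℝ) - 1) * pLog p e ^ (nbar + 3) := by
  set P := pLog p e with hPdef
  have hP : 0 ≤ P := zero_le_one.trans hp1
  have hΦ' : Φ ≤ cΦ * P / e := by rw [le_div_iff₀ he, mul_comm]; exact hΦ
  have hv' : ‖v x‖ ≤ cΦ * P / e := hvx.trans hΦ'
  have hVc' : Vc ≤ cΦ * P / e := hVcΦ.trans hΦ'
  refine (abs_dltW_sub_dlt_one_le (a := a) (A := A) hδ'0 hVc hγ₁ hδG0 hU hA' hw hcol hG1 hGpd x).trans ?_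
  calc (1 / 2) * a ^ 2 * (‖v x‖ * (2 * δ' * (Vc * γ₁) + Vc * δG))
      ≤ (1 / 2) * a ^ 2 * ((cΦ * P / e) * (2 * (cΓ * e * E * S₁ * (ca * P)) * ((cΦ * P / e) * g)
          + (cΦ * P / e) * (cdG * e * E * P))) := by
        refine mul_le_mul_of_nonneg_left ?_ (by positivity)
        refine mul_le_mul hv' ?_ (by positivity) (by positivity)
        exact add_le_add (mul_le_mul (mul_le_mul_of_nonneg_left hδ' zero_le_two) (mul_le_mul hVc' hγ₁g hγ₁ (by positivity))
          (by positivity) (by positivity)) (mul_le_mul hVc' hδG hδG0 (by positivity))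
    _ = (1 / 2) * a ^ 2 * cΦ ^ 2 * (2 * cΓ * S₁ * ca * g) * (E / e) * P ^ 3
        + (1 / 2) * a ^ 2 * cΦ ^ 2 * cdG * (E / e) * P ^ 3 := by field_simp
    _ ≤ (1 / 2) * a ^ 2 * cΦ ^ 2 * (2 * cΓ * S₁ * ca * g) * e ^ ((nbar : ℝ) - 1) * P ^ (nbar + 3)
        + (1 / 2) * a ^ 2 * cΦ ^ 2 * cdG * e ^ ((nbar : ℝ) - 1) * P ^ (nbar + 3) :=
        add_le_add (currency_step he hp1 hEe (by positivity) (by omega)) (currency_step he hp1 hEe (by positivity) (by omega))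
    _ = _ := by ring

/-- **Piece 4 in print's currency** (localization `δR`): difference-kernel regularity `γ^d_m ≤ δ_w·m!·C_Gᵐ` with `δ_w ≤ c_w·E` (the
`w₆′` size of the companion (5.6.12) files), `A₀ ≤ c_Ae·p`, `C_G ≤ c_Ge·p`, regime `(2c_A + c_G)e·p ≤ 1`.
[cite: BalabanImbrieJaffe1988, (5.6.14) p.288] -/
theorem abs_deltaR_le_scale {e p cA cG cΦ cw A₀ CG Vc Φ δw E : ℝ} {γd : ℕ → ℝ} {nbar : ℕ} (he : 0 < e)
    (hp1 : 1 ≤ pLog p e) (hcA : 0 ≤ cA) (hcG : 0 ≤ cG) (hcΦ : 0 ≤ cΦ) (hcw : 0 ≤ cw) (hA₀ : 0 ≤ A₀) (hCG0 : 0 ≤ CG)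
    (hVc : 0 ≤ Vc) (hδw0 : 0 ≤ δw) (hEe : E ≤ e ^ (nbar : ℝ)) (hγd0 : ∀ m, 0 ≤ γd m)
    (hγdle : ∀ m, γd m ≤ δw * m.factorial * CG ^ m) (hA₀e : A₀ ≤ cA * e * pLog p e) (hCGe : CG ≤ cG * e * pLog p e)
    (hreg : (2 * cA + cG) * e * pLog p e ≤ 1) (hVcΦ : Vc ≤ Φ) (hΦ : e * Φ ≤ cΦ * pLog p e) (hδw : δw ≤ cw * E)
    (hG : ∀ z z', ∀ n : ℕ, ContDiff ℝ n (fun t => G t z z')) (hG' : ∀ z z', ∀ n : ℕ, ContDiff ℝ n (fun t => G' t z z'))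
    (hU : ∀ y z, z ∈ B y → ‖U y z‖ ≤ 1) (hA : ∀ y z, z ∈ B y → |A y z| ≤ A₀) (hw : ∀ x, |w| * (B x).card ≤ 1)
    (hcol : ∀ z', ∑ y ∈ Y.filter (fun y => z' ∈ B y), |w| * ‖v y‖ ≤ Vc)
    (hγdG : ∀ m ≤ nbar, ∀ z, ∑ z', ‖iteratedDeriv m (fun s => G s z z' - G' s z z') 0‖ ≤ γd m) {x : β} (hvx : ‖v x‖ ≤ Φ) :
    |deltaR a B w U A G G' v Y nbar x|
      ≤ (1 / 2) * a ^ 2 * cΦ ^ 2 * (2 * cA + cG) * cw * nbar * e ^ ((nbar : ℝ) - 1) * pLog p e ^ (nbar + 3) := by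
  set P := pLog p e with hPdef
  have hP : 0 ≤ P := zero_le_one.trans hp1
  have hΦ' : Φ ≤ cΦ * P / e := by rw [le_div_iff₀ he, mul_comm]; exact hΦ
  have hv' : ‖v x‖ ≤ cΦ * P / e := hvx.trans hΦ'
  have hVc' : Vc ≤ cΦ * P / e := hVcΦ.trans hΦ'
  refine (abs_deltaR_le (a := a) hA₀ hVc hγd0 hG hG' hU hA hw hcol nbar hγdG x).trans ?_
  have hAC : 2 * A₀ + CG ≤ (2 * cA + cG) * e * P := by linarith
  have hAC0 : 0 ≤ 2 * A₀ + CG := by positivity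
  have hAC1 : 2 * A₀ + CG ≤ 1 := hAC.trans hreg
  have hsum : ∑ n ∈ Finset.range nbar, Gamma A₀ γd (n + 1) / (n + 1).factorial ≤ nbar * (δw * ((2 * cA + cG) * e * P)) := by
    calc ∑ n ∈ Finset.range nbar, Gamma A₀ γd (n + 1) / (n + 1).factorial
        ≤ ∑ n ∈ Finset.range nbar, δw * ((2 * cA + cG) * e * P) := Finset.sum_le_sum fun n _ => by
          have hΓ := Gamma_le_of_factorial hA₀ hδw0 hCG0 hγdle (n + 1)
          rw [div_le_iff₀ (by positivity : (0 : ℝ) < (n + 1).factorial)]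
          calc Gamma A₀ γd (n + 1) ≤ δw * (n + 1).factorial * (2 * A₀ + CG) ^ (n + 1) := hΓ
            _ = δw * ((2 * A₀ + CG) ^ n * (2 * A₀ + CG)) * (n + 1).factorial := by ring
            _ ≤ δw * (1 * ((2 * cA + cG) * e * P)) * (n + 1).factorial := by
                gcongr
                exact pow_le_one₀ hAC0 hAC1
            _ = δw * ((2 * cA + cG) * e * P) * (n + 1).factorial := by ring
      _ = nbar * (δw * ((2 * cA + cG) * e * P)) := by rw [Finset.sum_const, Finset.card_range, nsmul_eq_mul]
  have hvV : (1 / 2) * a ^ 2 * ‖v x‖ * Vc ≤ (1 / 2) * a ^ 2 * ((cΦ * P / e) * (cΦ * P / e)) := by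
    have h2 : ‖v x‖ * Vc ≤ (cΦ * P / e) * (cΦ * P / e) := mul_le_mul hv' hVc' hVc (by positivity)
    calc (1 / 2) * a ^ 2 * ‖v x‖ * Vc = (1 / 2) * a ^ 2 * (‖v x‖ * Vc) := by ring
      _ ≤ _ := mul_le_mul_of_nonneg_left h2 (by positivity)
  have hδw' : (nbar : ℝ) * (δw * ((2 * cA + cG) * e * P)) ≤ nbar * (cw * E * ((2 * cA + cG) * e * P)) :=
    mul_le_mul_of_nonneg_left (mul_le_mul_of_nonneg_right hδw (by positivity)) (Nat.cast_nonneg _)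
  calc (1 / 2) * a ^ 2 * ‖v x‖ * Vc * ∑ n ∈ Finset.range nbar, Gamma A₀ γd (n + 1) / (n + 1).factorial
      ≤ ((1 / 2) * a ^ 2 * ((cΦ * P / e) * (cΦ * P / e))) * (nbar * (cw * E * ((2 * cA + cG) * e * P))) :=
        mul_le_mul hvV (hsum.trans hδw') (Finset.sum_nonneg fun n _ => div_nonneg (Gamma_nonneg hA₀ hγd0 _) (Nat.cast_nonneg _))
          (by positivity)
    _ = (1 / 2) * a ^ 2 * cΦ ^ 2 * (2 * cA + cG) * cw * nbar * (E / e) * P ^ 3 := by field_simp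
    _ ≤ _ := currency_step he hp1 hEe (by positivity) (by omega)

/-- **The complete `Δ_{k,loc}` site bound in print's currency** — the four pieces (`abs_dltPhys_sub_dltW_le_scale`,
`abs_dltW_sub_dlt_one_le_scale`, the companion's `abs_W1dlt_le_scale`, `abs_deltaR_le_scale`): `|W₁,Δ,tot(x)| ≤ K·e^{n̄−1}·p^{n̄+3}`
with `K = dltTotConst …`. [cite: BalabanImbrieJaffe1988, (5.6.13) p.288] -/
theorem abs_W1dltTot_le_scale {e p g cA cG cΦ S₁ S₂ ca cΓ cdG cw A₀ CG Vc Φ γp γ₁ δ δ' δG δw E : ℝ} {γ γd : ℕ → ℝ}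
    {nbar : ℕ} (he : 0 < e) (hp1 : 1 ≤ pLog p e) (hg : 0 ≤ g) (hcA : 0 ≤ cA) (hcG : 0 ≤ cG) (hcΦ : 0 ≤ cΦ)
    (hS₁ : 0 ≤ S₁) (hS₂ : 0 ≤ S₂) (hca : 0 ≤ ca) (hcΓ : 0 ≤ cΓ) (hcdG : 0 ≤ cdG) (hcw : 0 ≤ cw) (hA₀ : 0 ≤ A₀)
    (hCG0 : 0 ≤ CG) (hVc : 0 ≤ Vc) (hγp : 0 ≤ γp) (hγ₁ : 0 ≤ γ₁) (hδ0 : 0 ≤ δ) (hδ1 : δ ≤ 1) (hδ'0 : 0 ≤ δ')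
    (hδG0 : 0 ≤ δG) (hδw0 : 0 ≤ δw) (hE0 : 0 ≤ E) (hEe : E ≤ e ^ (nbar : ℝ)) (hγ0 : ∀ m, 0 ≤ γ m) (hγd0 : ∀ m, 0 ≤ γd m)
    (hγ : ∀ m, γ m ≤ g * m.factorial * CG ^ m) (hγdle : ∀ m, γd m ≤ δw * m.factorial * CG ^ m)
    (hA₀e : A₀ ≤ cA * e * pLog p e) (hCGe : CG ≤ cG * e * pLog p e) (hreg : (2 * cA + cG) * e * pLog p e ≤ 1)
    (hγpg : γp ≤ g) (hγ₁g : γ₁ ≤ g) (hVcΦ : Vc ≤ Φ) (hΦ : e * Φ ≤ cΦ * pLog p e)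
    (hδ : δ ≤ 2 * e * E * S₂ * (ca * pLog p e)) (hδ' : δ' ≤ cΓ * e * E * S₁ * (ca * pLog p e)) (hδG : δG ≤ cdG * e * E * pLog p e)
    (hδw : δw ≤ cw * E)
    (hG : ∀ z z', ∀ n : ℕ, ContDiff ℝ n (fun t => G t z z')) (hG' : ∀ z z', ∀ n : ℕ, ContDiff ℝ n (fun t => G' t z z'))
    (hU : ∀ y z, z ∈ B y → ‖U y z‖ ≤ 1) (hA : ∀ y z, z ∈ B y → |A y z| ≤ A₀) (hA' : ∀ y z, z ∈ B y → |A' y z| ≤ δ')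
    (hw : ∀ x, |w| * (B x).card ≤ 1) (hcol : ∀ z', ∑ y ∈ Y.filter (fun y => z' ∈ B y), |w| * ‖v y‖ ≤ Vc)
    (hPφ : ∀ y, ‖Pφ y - 1‖ ≤ δ) (hGp : ∀ z, ∑ z', ‖Gp z z'‖ ≤ γp) (hG1 : ∀ z, ∑ z', ‖G 1 z z'‖ ≤ γ₁)
    (hGpd : ∀ z, ∑ z', ‖Gp z z' - G 1 z z'‖ ≤ δG)
    (hγG : ∀ t ∈ Set.Icc (0 : ℝ) 1, ∀ m ≤ nbar + 1, ∀ z, ∑ z', ‖iteratedDeriv m (fun s => G s z z') t‖ ≤ γ m)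
    (hγdG : ∀ m ≤ nbar, ∀ z, ∑ z', ‖iteratedDeriv m (fun s => G s z z' - G' s z z') 0‖ ≤ γd m) {x : β}
    (hvx : ‖v x‖ ≤ Φ) :
    |W1dltTot a B w U A A' Pφ Gp G G' v Y nbar x|
      ≤ dltTotConst a g cA cG cΦ S₁ S₂ ca cΓ cdG cw nbar * e ^ ((nbar : ℝ) - 1) * pLog p e ^ (nbar + 3) := by
  have hΦ0 : 0 ≤ Φ := (norm_nonneg _).trans hvx
  have h1 := abs_dltPhys_sub_dltW_le_scale (a := a) (A := A) (A' := A') he hp1 hg hcΦ hS₂ hca hVc hγp hδ0 hδ1 hE0 hEe hγpg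
    hVcΦ hΦ hδ hU hw hcol hPφ hGp hvx
  have h2 := abs_dltW_sub_dlt_one_le_scale (a := a) (A := A) he hp1 hg hcΦ hS₁ hca hcΓ hcdG hVc hγ₁ hδ'0 hδG0 hE0 hEe hγ₁g
    hVcΦ hΦ hδ' hδG hU hA' hw hcol hG1 hGpd hvx
  have h3 : |W1dlt a B w U A G v Y nbar x|
      ≤ BIJ88Eq5613DeltaLoc.dltConst a g cA cG cΦ nbar * e ^ ((nbar : ℝ) - 1) * pLog p e ^ (nbar + 3) :=
    BIJ88Eq5613DeltaLoc.abs_W1dlt_le_scale he hg hcΦ hA₀ hCG0 hVc hγ0 hγ hA₀e hCGe hVcΦ hΦ hG hU hA hw hcol nbar hγG hvx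
  have h4 := abs_deltaR_le_scale (a := a) he hp1 hcA hcG hcΦ hcw hA₀ hCG0 hVc hδw0 hEe hγd0 hγdle hA₀e hCGe hreg hVcΦ hΦ
    hδw hG hG' hU hA hw hcol hγdG hvx
  rw [W1dltTot_eq_sources]
  calc _ ≤ |dltPhys a B w U A A' Pφ Gp v Y x - dltW a B w U A A' Gp v Y x|
        + |dltW a B w U A A' Gp v Y x - dlt a B w U A G v Y 1 x| + |W1dlt a B w U A G v Y nbar x|
        + |deltaR a B w U A G G' v Y nbar x| :=
        (abs_add_le _ _).trans (add_le_add ((abs_add_le _ _).trans (add_le_add (abs_add_le _ _) le_rfl)) le_rfl)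
    _ ≤ (3 * |a| * S₂ * ca * cΦ ^ 2 + 3 * a ^ 2 * S₂ * ca * cΦ ^ 2 * g) * e ^ ((nbar : ℝ) - 1) * pLog p e ^ (nbar + 3)
        + (1 / 2) * a ^ 2 * cΦ ^ 2 * (2 * cΓ * S₁ * ca * g + cdG) * e ^ ((nbar : ℝ) - 1) * pLog p e ^ (nbar + 3)
        + BIJ88Eq5613DeltaLoc.dltConst a g cA cG cΦ nbar * e ^ ((nbar : ℝ) - 1) * pLog p e ^ (nbar + 3)
        + (1 / 2) * a ^ 2 * cΦ ^ 2 * (2 * cA + cG) * cw * nbar * e ^ ((nbar : ℝ) - 1) * pLog p e ^ (nbar + 3) :=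
        add_le_add (add_le_add (add_le_add h1 h2) h3) h4
    _ = dltTotConst a g cA cG cΦ S₁ S₂ ca cΓ cdG cw nbar * e ^ ((nbar : ℝ) - 1) * pLog p e ^ (nbar + 3) := by
        unfold dltTotConst; ring

end DeltaScale

/-! ## §4 The `𝒫_{k,loc}` site term under displayed hypotheses -/

section PTerm

variable {ι : Type}

/-- **The `𝒫_{k,loc}` site term `W₁,𝒫(x)`** of (5.6.13): the bookkeeping `W1` for a displayed physical value `𝒫_phys(x)`, a
displayed site family `𝒫_x(e′)` and a displayed localization `δR_𝒫(x)` — p. 275: *"𝒫_{k,loc} … given by a perturbation expansion up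
to some fixed order n̄, which we describe in detail in a later paper"* (its form beyond (5.2.5) is not printed in §5).
[cite: BalabanImbrieJaffe1988, (5.6.13) p.288] -/
def W1PTot (Pphys : ι → ℝ) (Pfam : ι → ℝ → ℝ) (δRP : ι → ℝ) (nbar : ℕ) (x : ι) : ℝ :=
  W1 (Pphys x) (Pfam x) nbar (δRP x)

/-- **(5.6.13), `𝒫_{k,loc}` term**: `𝒫_phys(x) = 𝒫_x(0) + (R̃_𝒫(x) − δR_𝒫(x)) + W₁,𝒫(x)`. [cite: BalabanImbrieJaffe1988, (5.6.13) p.288] -/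
theorem eq5613_PTot_site (Pphys : ι → ℝ) (Pfam : ι → ℝ → ℝ) (δRP : ι → ℝ) (nbar : ℕ) (x : ι) :
    Pphys x = Pfam x 0 + (Rtilde (Pfam x) nbar - δRP x) + W1PTot Pphys Pfam δRP nbar x :=
  eq5613 (Pphys x) (Pfam x) nbar (δRP x)

/-- **The `𝒫_{k,loc}` site bound** from displayed sources and a displayed `(n̄+1)`-st derivative bound.
[cite: BalabanImbrieJaffe1988, (5.6.13) p.288] -/
theorem abs_W1PTot_le {Pphys Pw : ι → ℝ} {Pfam : ι → ℝ → ℝ} {δRP : ι → ℝ} {nbar : ℕ} {x : ι} {εφ εw εR CP : ℝ}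
    (hPf : ∀ n : ℕ, ContDiff ℝ n (Pfam x)) (hCP : ∀ t ∈ Set.Icc (0 : ℝ) 1, |iteratedDeriv (nbar + 1) (Pfam x) t| ≤ CP)
    (hφ : |Pphys x - Pw x| ≤ εφ) (hw : |Pw x - Pfam x 1| ≤ εw) (hR : |δRP x| ≤ εR) :
    |W1PTot Pphys Pfam δRP nbar x| ≤ εφ + εw + CP / nbar.factorial + εR := by
  rw [W1PTot, W1_eq_sources _ (Pw x)]
  have h3 : |Ftilde (Pfam x) nbar| ≤ CP / nbar.factorial := by
    have h := norm_Ftilde_le_of_contDiff hPf (fun t ht => by rw [Real.norm_eq_abs]; exact hCP t ht)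
    rwa [Real.norm_eq_abs] at h
  calc _ ≤ |Pphys x - Pw x| + |Pw x - Pfam x 1| + |Ftilde (Pfam x) nbar| + |δRP x| :=
        (abs_add_le _ _).trans (add_le_add ((abs_add_le _ _).trans (add_le_add (abs_add_le _ _) le_rfl)) le_rfl)
    _ ≤ _ := add_le_add (add_le_add (add_le_add hφ hw) h3) hR

/-- The constant of the `𝒫_{k,loc}` bound. [cite: BalabanImbrieJaffe1988, (5.6.13) p.288] -/
def PTotConst (c₁ c₂ c₃ cP : ℝ) : ℝ := c₁ + c₂ + cP + c₃

/-- kernel: `K ≥ 0`. [cite: BalabanImbrieJaffe1988, (5.6.13) p.288] -/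
theorem PTotConst_nonneg {c₁ c₂ c₃ cP : ℝ} (h₁ : 0 ≤ c₁) (h₂ : 0 ≤ c₂) (h₃ : 0 ≤ c₃) (hP : 0 ≤ cP) :
    0 ≤ PTotConst c₁ c₂ c₃ cP := by
  unfold PTotConst; positivity

/-- **The `𝒫_{k,loc}` site bound in print's currency** — DISPLAYED hypotheses: the three sources of size `cᵢ·(eE)·(p/e)²` (one
charge, the (5.4.7)/`w₆` exponential `E`, two field factors) and the derivative bound `|𝒫_x^{(n̄+1)}| ≤ c_𝒫(ep)^{n̄+1}(p/e)²`; with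
`E ≤ e^{n̄}`, `p ≥ 1`: `|W₁,𝒫(x)| ≤ K·e^{n̄−1}p^{n̄+3}`. [cite: BalabanImbrieJaffe1988, (5.6.13) p.288] -/
theorem abs_W1PTot_le_scale {Pphys Pw : ι → ℝ} {Pfam : ι → ℝ → ℝ} {δRP : ι → ℝ} {nbar : ℕ} {x : ι}
    {e p c₁ c₂ c₃ cP E : ℝ} (he : 0 < e) (hp1 : 1 ≤ pLog p e) (h₁ : 0 ≤ c₁) (h₂ : 0 ≤ c₂) (h₃ : 0 ≤ c₃)
    (hcP : 0 ≤ cP) (hEe : E ≤ e ^ (nbar : ℝ)) (hPf : ∀ n : ℕ, ContDiff ℝ n (Pfam x))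
    (hPd : ∀ t ∈ Set.Icc (0 : ℝ) 1,
      |iteratedDeriv (nbar + 1) (Pfam x) t| ≤ cP * (e * pLog p e) ^ (nbar + 1) * (pLog p e / e) ^ 2)
    (hφ : |Pphys x - Pw x| ≤ c₁ * (e * E) * (pLog p e / e) ^ 2) (hw : |Pw x - Pfam x 1| ≤ c₂ * (e * E) * (pLog p e / e) ^ 2)
    (hR : |δRP x| ≤ c₃ * (e * E) * (pLog p e / e) ^ 2) :
    |W1PTot Pphys Pfam δRP nbar x| ≤ PTotConst c₁ c₂ c₃ cP * e ^ ((nbar : ℝ) - 1) * pLog p e ^ (nbar + 3) := by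
  set P := pLog p e with hPdef
  have hP : 0 ≤ P := zero_le_one.trans hp1
  have henn : 0 ≤ e ^ ((nbar : ℝ) - 1) := Real.rpow_nonneg he.le _
  have hpow1 : e ^ (nbar + 1) / e / e = e ^ ((nbar : ℝ) - 1) := by
    rw [div_div, ← pow_two, ← Real.rpow_natCast, ← Real.rpow_natCast, ← Real.rpow_sub he]; push_cast; ring_nf
  have hpow2 : E / e ≤ e ^ ((nbar : ℝ) - 1) := by
    rw [div_le_iff₀ he, Real.rpow_sub he, Real.rpow_one, div_mul_cancel₀ _ he.ne']; exact hEe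
  have hP2 : P ^ 2 ≤ P ^ (nbar + 3) := pow_le_pow_right₀ hp1 (by omega)
  have step : ∀ c : ℝ, 0 ≤ c → c * (e * E) * (P / e) ^ 2 ≤ c * e ^ ((nbar : ℝ) - 1) * P ^ (nbar + 3) := fun c hc =>
    calc c * (e * E) * (P / e) ^ 2 = c * (E / e) * P ^ 2 := by field_simp
      _ ≤ c * e ^ ((nbar : ℝ) - 1) * P ^ 2 := mul_le_mul_of_nonneg_right (mul_le_mul_of_nonneg_left hpow2 hc) (pow_nonneg hP 2)
      _ ≤ _ := mul_le_mul_of_nonneg_left hP2 (mul_nonneg hc henn)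
  have hnf : (1 : ℝ) ≤ nbar.factorial := by exact_mod_cast Nat.succ_le_of_lt (Nat.factorial_pos nbar)
  have h3 : cP * (e * P) ^ (nbar + 1) * (P / e) ^ 2 / nbar.factorial ≤ cP * e ^ ((nbar : ℝ) - 1) * P ^ (nbar + 3) := by
    have hnum : cP * (e * P) ^ (nbar + 1) * (P / e) ^ 2 = cP * e ^ ((nbar : ℝ) - 1) * P ^ (nbar + 3) := by
      rw [← hpow1]; field_simp; ring
    rw [hnum]
    exact div_le_self (mul_nonneg (mul_nonneg hcP henn) (pow_nonneg hP _)) hnf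
  refine (abs_W1PTot_le hPf hPd hφ hw hR).trans ?_
  calc c₁ * (e * E) * (P / e) ^ 2 + c₂ * (e * E) * (P / e) ^ 2 + cP * (e * P) ^ (nbar + 1) * (P / e) ^ 2 / nbar.factorial
        + c₃ * (e * E) * (P / e) ^ 2
      ≤ c₁ * e ^ ((nbar : ℝ) - 1) * P ^ (nbar + 3) + c₂ * e ^ ((nbar : ℝ) - 1) * P ^ (nbar + 3)
        + cP * e ^ ((nbar : ℝ) - 1) * P ^ (nbar + 3) + c₃ * e ^ ((nbar : ℝ) - 1) * P ^ (nbar + 3) :=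
        add_le_add (add_le_add (add_le_add (step _ h₁) (step _ h₂)) h3) (step _ h₃)
    _ = PTotConst c₁ c₂ c₃ cP * e ^ ((nbar : ℝ) - 1) * P ^ (nbar + 3) := by unfold PTotConst; ring

end PTerm

/-! ## §5 The whole cube term `W₁^{(k)}(□)` of (5.6.13) -/

section Assembly

variable {ι₁ ι₀ γ : Type} [DecidableEq γ]

/-- Three-part cube term: a kinetic part over the `ψ`-sites `Y₁` (cube map `cube₁`) plus a `Δ_{k,loc}` part and a `𝒫_{k,loc}` part
over the `φ`-sites `X` (cube map `cube₀`). [cite: BalabanImbrieJaffe1988, (5.6.13) p.288] -/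
def cubeSum₃ (Y₁ : Finset ι₁) (cube₁ : ι₁ → γ) (T₁ : ι₁ → ℝ) (X : Finset ι₀) (cube₀ : ι₀ → γ) (T₂ T₃ : ι₀ → ℝ)
    (c : γ) : ℝ :=
  cubeSum Y₁ cube₁ T₁ c + (cubeSum X cube₀ T₂ c + cubeSum X cube₀ T₃ c)

omit [DecidableEq γ] in
/-- kernel: summing the cube terms over any finite set of cubes containing the cubes met gives back the site sum.
[cite: BalabanImbrieJaffe1988, (5.6.13) p.288] -/
theorem sum_cubeSum_of_superset [DecidableEq γ] {σ : Type} (Y : Finset σ) (cube : σ → γ) (f : σ → ℝ) {C : Finset γ}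
    (hC : Y.image cube ⊆ C) : ∑ c ∈ C, cubeSum Y cube f c = ∑ y ∈ Y, f y := by
  rw [sum_eq_sum_cubeSum Y cube f]
  exact (Finset.sum_subset hC fun c _ hc => BIJ88Eq5613Summary.cubeSum_eq_zero_of_not_mem Y cube f hc).symm

/-- **(5.6.13) for three summed site terms**: left sides = main terms + `R`-terms + `Σ_□` of the three-part cube term, over any
finite set of cubes `C` containing the cubes met. [cite: BalabanImbrieJaffe1988, (5.6.13) p.288] -/
theorem eq5613_three (Y₁ : Finset ι₁) (cube₁ : ι₁ → γ) (S₁ : ι₁ → ℝ) (F₁ : ι₁ → ℝ → ℝ) (δR₁ : ι₁ → ℝ) (X : Finset ι₀)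
    (cube₀ : ι₀ → γ) (S₂ S₃ : ι₀ → ℝ) (F₂ F₃ : ι₀ → ℝ → ℝ) (δR₂ δR₃ : ι₀ → ℝ) (nbar : ℕ) {C : Finset γ}
    (h₁ : Y₁.image cube₁ ⊆ C) (h₀ : X.image cube₀ ⊆ C) :
    ∑ y ∈ Y₁, S₁ y + ∑ x ∈ X, S₂ x + ∑ x ∈ X, S₃ x
      = (∑ y ∈ Y₁, F₁ y 0 + ∑ x ∈ X, F₂ x 0 + ∑ x ∈ X, F₃ x 0)
        + (∑ y ∈ Y₁, (Rtilde (F₁ y) nbar - δR₁ y) + ∑ x ∈ X, (Rtilde (F₂ x) nbar - δR₂ x)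
            + ∑ x ∈ X, (Rtilde (F₃ x) nbar - δR₃ x))
        + ∑ c ∈ C, cubeSum₃ Y₁ cube₁ (fun y => W1 (S₁ y) (F₁ y) nbar (δR₁ y)) X cube₀
            (fun x => W1 (S₂ x) (F₂ x) nbar (δR₂ x)) (fun x => W1 (S₃ x) (F₃ x) nbar (δR₃ x)) c := by
  have e₁ : ∑ y ∈ Y₁, S₁ y = ∑ y ∈ Y₁, F₁ y 0 + ∑ y ∈ Y₁, (Rtilde (F₁ y) nbar - δR₁ y)
      + ∑ y ∈ Y₁, W1 (S₁ y) (F₁ y) nbar (δR₁ y) := by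
    rw [← Finset.sum_add_distrib, ← Finset.sum_add_distrib]
    exact Finset.sum_congr rfl fun y _ => eq5613 (S₁ y) (F₁ y) nbar (δR₁ y)
  have e₂ : ∑ x ∈ X, S₂ x = ∑ x ∈ X, F₂ x 0 + ∑ x ∈ X, (Rtilde (F₂ x) nbar - δR₂ x)
      + ∑ x ∈ X, W1 (S₂ x) (F₂ x) nbar (δR₂ x) := by
    rw [← Finset.sum_add_distrib, ← Finset.sum_add_distrib]
    exact Finset.sum_congr rfl fun x _ => eq5613 (S₂ x) (F₂ x) nbar (δR₂ x)
  have e₃ : ∑ x ∈ X, S₃ x = ∑ x ∈ X, F₃ x 0 + ∑ x ∈ X, (Rtilde (F₃ x) nbar - δR₃ x)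
      + ∑ x ∈ X, W1 (S₃ x) (F₃ x) nbar (δR₃ x) := by
    rw [← Finset.sum_add_distrib, ← Finset.sum_add_distrib]
    exact Finset.sum_congr rfl fun x _ => eq5613 (S₃ x) (F₃ x) nbar (δR₃ x)
  simp only [cubeSum₃, Finset.sum_add_distrib]
  rw [sum_cubeSum_of_superset Y₁ cube₁ _ h₁, sum_cubeSum_of_superset X cube₀ _ h₀, sum_cubeSum_of_superset X cube₀ _ h₀,
    e₁, e₂, e₃]
  ring

/-- kernel: **the three-part cube bound** — per-site bounds `Kᵢ·M` and at most `L` sites of each kind per cube give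
`|W(□)| ≤ (K₁ + K₂ + K₃)·M·L`. [cite: BalabanImbrieJaffe1988, (5.6.13) p.288] -/
theorem abs_cubeSum₃_le {Y₁ : Finset ι₁} {cube₁ : ι₁ → γ} {T₁ : ι₁ → ℝ} {X : Finset ι₀} {cube₀ : ι₀ → γ} {T₂ T₃ : ι₀ → ℝ}
    {K₁ K₂ K₃ M L : ℝ} (hK₁ : 0 ≤ K₁) (hK₂ : 0 ≤ K₂) (hK₃ : 0 ≤ K₃) (hM : 0 ≤ M)
    (h₁ : ∀ y ∈ Y₁, |T₁ y| ≤ K₁ * M) (h₂ : ∀ x ∈ X, |T₂ x| ≤ K₂ * M) (h₃ : ∀ x ∈ X, |T₃ x| ≤ K₃ * M) (c : γ)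
    (hcard₁ : ((Y₁.filter (fun y => cube₁ y = c)).card : ℝ) ≤ L) (hcard₀ : ((X.filter (fun x => cube₀ x = c)).card : ℝ) ≤ L) :
    |cubeSum₃ Y₁ cube₁ T₁ X cube₀ T₂ T₃ c| ≤ (K₁ + K₂ + K₃) * M * L := by
  have b₁ := norm_cubeSum_le Y₁ cube₁ T₁ c (b := K₁ * M) (fun y hy _ => by rw [Real.norm_eq_abs]; exact h₁ y hy)
  have b₂ := norm_cubeSum_le X cube₀ T₂ c (b := K₂ * M) (fun x hx _ => by rw [Real.norm_eq_abs]; exact h₂ x hx)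
  have b₃ := norm_cubeSum_le X cube₀ T₃ c (b := K₃ * M) (fun x hx _ => by rw [Real.norm_eq_abs]; exact h₃ x hx)
  rw [Real.norm_eq_abs] at b₁ b₂ b₃
  unfold cubeSum₃
  calc _ ≤ |cubeSum Y₁ cube₁ T₁ c| + (|cubeSum X cube₀ T₂ c| + |cubeSum X cube₀ T₃ c|) :=
        (abs_add_le _ _).trans (add_le_add le_rfl (abs_add_le _ _))
    _ ≤ ((Y₁.filter (fun y => cube₁ y = c)).card : ℝ) * (K₁ * M)
        + (((X.filter (fun x => cube₀ x = c)).card : ℝ) * (K₂ * M) + ((X.filter (fun x => cube₀ x = c)).card : ℝ) * (K₃ * M)) :=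
        add_le_add b₁ (add_le_add b₂ b₃)
    _ ≤ L * (K₁ * M) + (L * (K₂ * M) + L * (K₃ * M)) :=
        add_le_add (mul_le_mul_of_nonneg_right hcard₁ (mul_nonneg hK₁ hM))
          (add_le_add (mul_le_mul_of_nonneg_right hcard₀ (mul_nonneg hK₂ hM)) (mul_le_mul_of_nonneg_right hcard₀ (mul_nonneg hK₃ hM)))
    _ = (K₁ + K₂ + K₃) * M * L := by ring

/-- **`|W₁^{(k)}(□)| ≦ e_k^{n̄−1−α}` for a three-part cube term** — r16's leaf `BIJ88Sect5StatementsPart2.Ineq5613` from per-site scale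
bounds `|Tᵢ| ≤ Kᵢ·e^{n̄−1}·p(e)^{n̄+3}`, `≤ r(e)^d` sites of each kind per cube, `0 < e ≤ min(e⁻¹, e₀)` with
`e₀ = BIJ88Eq5613Summary.threshold (K₁+K₂+K₃) q α`, `q = kinLogPower p r d n̄ > 0`. [cite: BalabanImbrieJaffe1988, (5.6.13) p.288] -/
theorem ineq5613_three {Y₁ : Finset ι₁} {cube₁ : ι₁ → γ} {T₁ : ι₁ → ℝ} {X : Finset ι₀} {cube₀ : ι₀ → γ} {T₂ T₃ : ι₀ → ℝ}
    {K₁ K₂ K₃ e p r α' : ℝ} {d nbar : ℕ} (he : 0 < e) (he1 : e ≤ Real.exp (-1)) (hK₁ : 0 ≤ K₁) (hK₂ : 0 ≤ K₂) (hK₃ : 0 ≤ K₃)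
    (hα : 0 < α') (hq : 0 < kinLogPower p r d nbar)
    (h₁ : ∀ y ∈ Y₁, |T₁ y| ≤ K₁ * e ^ ((nbar : ℝ) - 1) * pLog p e ^ (nbar + 3))
    (h₂ : ∀ x ∈ X, |T₂ x| ≤ K₂ * e ^ ((nbar : ℝ) - 1) * pLog p e ^ (nbar + 3))
    (h₃ : ∀ x ∈ X, |T₃ x| ≤ K₃ * e ^ ((nbar : ℝ) - 1) * pLog p e ^ (nbar + 3))
    (hcard₁ : ∀ c, ((Y₁.filter (fun y => cube₁ y = c)).card : ℝ) ≤ rLen r e ^ d)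
    (hcard₀ : ∀ c, ((X.filter (fun x => cube₀ x = c)).card : ℝ) ≤ rLen r e ^ d)
    (hth : e ≤ threshold (K₁ + K₂ + K₃) (kinLogPower p r d nbar) α') :
    Ineq5613 γ (cubeSum₃ Y₁ cube₁ T₁ X cube₀ T₂ T₃) e nbar α' := by
  have he1' : e ≤ 1 := le_one_of_le_exp_neg_one he1
  intro c
  have hM : 0 ≤ e ^ ((nbar : ℝ) - 1) * pLog p e ^ (nbar + 3) :=
    mul_nonneg (Real.rpow_nonneg he.le _) (pow_nonneg (Real.rpow_nonneg (abs_nonneg _) _) _)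
  have h := abs_cubeSum₃_le hK₁ hK₂ hK₃ hM (fun y hy => (h₁ y hy).trans_eq (mul_assoc _ _ _))
    (fun x hx => (h₂ x hx).trans_eq (mul_assoc _ _ _)) (fun x hx => (h₃ x hx).trans_eq (mul_assoc _ _ _)) c (hcard₁ c) (hcard₀ c)
  refine BIJ88Eq5613Summary.absorb_logs_nbar (K := K₁ + K₂ + K₃) (q := kinLogPower p r d nbar) (by positivity) hq hα he he1'
    hth (h.trans (le_of_eq ?_))
  calc (K₁ + K₂ + K₃) * (e ^ ((nbar : ℝ) - 1) * pLog p e ^ (nbar + 3)) * rLen r e ^ d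
      = (K₁ + K₂ + K₃) * e ^ ((nbar : ℝ) - 1) * (pLog p e ^ (nbar + 3) * rLen r e ^ d) := by ring
    _ = (K₁ + K₂ + K₃) * e ^ ((nbar : ℝ) - 1) * Real.log e⁻¹ ^ kinLogPower p r d nbar := by
        congr 1
        rw [pLog_eq_rpow he he1', rLen_eq_rpow he he1', log_rpow_pow he he1', log_rpow_pow he he1',
          log_rpow_mul_log_rpow he he1, kinLogPower]
        push_cast; ring_nf

end Assembly

/-! ## §6 The instance of record: `W₁^{(k)}(□)` of (5.6.13) with all three summands -/

section Instance

variable {ι₁ ι₀ ιη γ : Type} [Fintype ιη] [DecidableEq ιη] [DecidableEq γ]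

/-- **`W₁^{(k)}(□)` of (5.6.13)** — THAT `W₁`: the complete kinetic cube term of `BIJ88Eq5613KineticSources` over the `ψ`-sites
(phase factors, `w₁` terms, order-`> n̄` Taylor remainder) plus, over the `φ`-sites, the complete `Δ_{k,loc}` site terms `W1dltTot`
(phase factors, `w₁` terms incl. the `w₁`-shift of the propagator, Taylor remainder, the `R̃ → R` localization `δR`) and the
`𝒫_{k,loc}` site terms `W1PTot` (displayed). [cite: BalabanImbrieJaffe1988, (5.6.13) p.288] -/
def W1tot (κ : ℝ) (Bk : ι₁ → Finset ι₀) (wk : ℝ) (Uk : ι₁ → ι₀ → ℂ) (Ak Ak' : ι₁ → ι₀ → ℝ) (Pψ : ι₁ → ℂ) (Pφ : ι₀ → ℂ)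
    (φ : ι₀ → ℂ) (ψ : ι₁ → ℂ) (a : ℝ) (Bd : ι₀ → Finset ιη) (wd : ℝ) (Ud : ι₀ → ιη → ℂ) (Ad Ad' : ι₀ → ιη → ℝ)
    (Gp : ιη → ιη → ℂ) (G G' : ℝ → ιη → ιη → ℂ) (v : ι₀ → ℂ) (Ycol : Finset ι₀) (Pphys : ι₀ → ℝ) (Pfam : ι₀ → ℝ → ℝ)
    (δRP : ι₀ → ℝ) (nbar : ℕ) (Yψ : Finset ι₁) (cube₁ : ι₁ → γ) (X : Finset ι₀) (cube₀ : ι₀ → γ) : γ → ℝ :=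
  cubeSum₃ Yψ cube₁ (W1kinTot κ Bk wk Uk Ak Ak' Pψ Pφ φ ψ nbar) X cube₀ (W1dltTot a Bd wd Ud Ad Ad' Pφ Gp G G' v Ycol nbar)
    (W1PTot Pphys Pfam δRP nbar)

/-- **(5.6.13)** for the full three-term action with the PHYSICAL left sides: `Σ_y S_kin,phys(y) + Σ_x S_Δ,phys(x) + Σ_x 𝒫_phys(x) =
[Σ_y S_y(0) + Σ_x d_x(0) + Σ_x 𝒫_x(0)] + [Σ_y R̃_kin(y) + Σ_x R̃[G′](x) + Σ_x (R̃_𝒫(x) − δR_𝒫(x))] + Σ_{□∈C} W₁^{(k)}(□)` — the middle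
bracket is `R^{(k)}`; `C` any finite set of cubes containing the cubes met. [cite: BalabanImbrieJaffe1988, (5.6.13) p.288] -/
theorem eq5613_total (κ : ℝ) (Bk : ι₁ → Finset ι₀) (wk : ℝ) (Uk : ι₁ → ι₀ → ℂ) (Ak Ak' : ι₁ → ι₀ → ℝ) (Pψ : ι₁ → ℂ)
    (Pφ : ι₀ → ℂ) (φ : ι₀ → ℂ) (ψ : ι₁ → ℂ) (a : ℝ) (Bd : ι₀ → Finset ιη) (wd : ℝ) (Ud : ι₀ → ιη → ℂ) (Ad Ad' : ι₀ → ιη → ℝ)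
    (Gp : ιη → ιη → ℂ) (G G' : ℝ → ιη → ιη → ℂ) (v : ι₀ → ℂ) (Ycol : Finset ι₀) (Pphys : ι₀ → ℝ) (Pfam : ι₀ → ℝ → ℝ)
    (δRP : ι₀ → ℝ) (nbar : ℕ) (Yψ : Finset ι₁) (cube₁ : ι₁ → γ) (X : Finset ι₀) (cube₀ : ι₀ → γ) {C : Finset γ}
    (h₁ : Yψ.image cube₁ ⊆ C) (h₀ : X.image cube₀ ⊆ C) :
    ∑ y ∈ Yψ, kinPhys κ Bk wk Uk Ak Ak' Pψ Pφ φ ψ y + ∑ x ∈ X, dltPhys a Bd wd Ud Ad Ad' Pφ Gp v Ycol x + ∑ x ∈ X, Pphys x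
      = (∑ y ∈ Yψ, kin κ Bk wk Uk Ak φ ψ y 0 + ∑ x ∈ X, dlt a Bd wd Ud Ad G v Ycol 0 x + ∑ x ∈ X, Pfam x 0)
        + (∑ y ∈ Yψ, Rtilde (kin κ Bk wk Uk Ak φ ψ y) nbar + ∑ x ∈ X, Rtilde (fun t => dlt a Bd wd Ud Ad G' v Ycol t x) nbar
            + ∑ x ∈ X, (Rtilde (Pfam x) nbar - δRP x))
        + ∑ c ∈ C, W1tot κ Bk wk Uk Ak Ak' Pψ Pφ φ ψ a Bd wd Ud Ad Ad' Gp G G' v Ycol Pphys Pfam δRP nbar Yψ cube₁ X cube₀ c := by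
  have h := eq5613_three Yψ cube₁ (kinPhys κ Bk wk Uk Ak Ak' Pψ Pφ φ ψ) (fun y => kin κ Bk wk Uk Ak φ ψ y) (fun _ => 0) X cube₀
    (dltPhys a Bd wd Ud Ad Ad' Pφ Gp v Ycol) Pphys (fun x t => dlt a Bd wd Ud Ad G v Ycol t x) Pfam
    (deltaR a Bd wd Ud Ad G G' v Ycol nbar) δRP nbar h₁ h₀
  have hR : ∀ x, Rtilde (fun t => dlt a Bd wd Ud Ad G v Ycol t x) nbar - deltaR a Bd wd Ud Ad G G' v Ycol nbar x
      = Rtilde (fun t => dlt a Bd wd Ud Ad G' v Ycol t x) nbar := fun x => by unfold deltaR; ring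
  simp only [sub_zero, hR] at h
  rw [h]
  rfl

/-- **`|W₁^{(k)}(□)| ≦ e_k^{n̄−1−α}` for `W₁^{(k)}(□)` of (5.6.13)** — r16's row leaf `BIJ88Sect5StatementsPart2.Ineq5613` INHABITED
by `W₁ = W1tot …` (all three summands, all printed sources), under: the displayed small-field / regularity hypotheses of the three
summands in `p(e_k)` units; the `w₂` phase-factor size `δ` and the `w₁`-phase size `δ′` in the (5.4.7)-fed form of
`BIJ88Eq5613KineticSources` (`norm_phaseFactor_sub_one_le`, `abs_contourPhase_le_of_ineq547`); the displayed `w₁`-shift of the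
propagator, localization difference and `𝒫_{k,loc}` data in the same exponential currency `E = e^{−cr(e_k)}`; `≤ r(e_k)^d` sites
per cube; and every running charge `0 < e_k ≤ min(e⁻¹, e₀)` with `(log e_k⁻¹)^{r−1} ≥ n̄/c` (`e₀ = threshold (K_kin + K_Δ + K_𝒫)
q α`, all explicit). [cite: BalabanImbrieJaffe1988, (5.6.13) p.288] -/
theorem ineq5613_total
    -- data
    {κ : ℝ} {Bk : ι₁ → Finset ι₀} {wk : ℝ} {Uk : ι₁ → ι₀ → ℂ} {Ak Ak' : ι₁ → ι₀ → ℝ} {Pψ : ι₁ → ℂ} {Pφ : ι₀ → ℂ}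
    {φ : ι₀ → ℂ} {ψ : ι₁ → ℂ} {a : ℝ} {Bd : ι₀ → Finset ιη} {wd : ℝ} {Ud : ι₀ → ιη → ℂ} {Ad Ad' : ι₀ → ιη → ℝ}
    {Gp : ιη → ιη → ℂ} {G G' : ℝ → ιη → ιη → ℂ} {v : ι₀ → ℂ} {Ycol : Finset ι₀} {Pphys Pw : ι₀ → ℝ} {Pfam : ι₀ → ℝ → ℝ}
    {δRP : ι₀ → ℝ} {nbar d : ℕ} {Yψ : Finset ι₁} {cube₁ : ι₁ → γ} {X : Finset ι₀} {cube₀ : ι₀ → γ}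
    -- scales and constants
    {e p r cr α' : ℝ} {cGk cΦk cΨ S₁ S₂ ca cΓ Gk Φk Ψ δ δ' : ℝ}
    {g cA cC cΦd cdG cw A₀ CG Vc Φd γp γ₁ δG δw : ℝ} {γr γd : ℕ → ℝ} {c₁ c₂ c₃ cP : ℝ}
    -- the running charge and the regime
    (he : 0 < e) (he1 : e ≤ Real.exp (-1)) (hp : 0 ≤ p) (hr : 1 < r) (hcr : 0 < cr) (hα : 0 < α')
    (hbig : (nbar : ℝ) / cr ≤ Real.log e⁻¹ ^ (r - 1)) (hq : 0 < kinLogPower p r d nbar)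
    -- kinetic summand (as in `BIJ88Eq5613KineticSources.ineq5613_kinTot`)
    (hcGk : 0 ≤ cGk) (hcΦk : 0 ≤ cΦk) (hcΨ : 0 ≤ cΨ) (hS₁ : 0 ≤ S₁) (hS₂ : 0 ≤ S₂) (hca : 0 ≤ ca) (hcΓ : 0 ≤ cΓ)
    (hGk0 : 0 ≤ Gk) (hΦk0 : 0 ≤ Φk) (hδ0 : 0 ≤ δ) (hδ1 : δ ≤ 1) (hδ'0 : 0 ≤ δ') (hδ'1 : δ' ≤ 1)
    (hGk : Gk ≤ cGk * e * pLog p e) (hΦk : e * Φk ≤ cΦk * pLog p e) (hΨ : e * Ψ ≤ cΨ * pLog p e)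
    (hδ : δ ≤ 2 * e * Real.exp (-(cr * rLen r e)) * S₂ * (ca * pLog p e))
    (hδ' : δ' ≤ cΓ * e * Real.exp (-(cr * rLen r e)) * S₁ * (ca * pLog p e))
    (hUk : ∀ y ∈ Yψ, ∀ x ∈ Bk y, ‖Uk y x‖ ≤ 1) (hAk : ∀ y ∈ Yψ, ∀ x ∈ Bk y, |Ak y x| ≤ Gk)
    (hPψ : ∀ y ∈ Yψ, ‖Pψ y - 1‖ ≤ δ) (hPφ : ∀ x, ‖Pφ x - 1‖ ≤ δ) (hAk' : ∀ y ∈ Yψ, ∀ x ∈ Bk y, |Ak' y x| ≤ δ')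
    (hφ : ∀ y ∈ Yψ, ∀ x ∈ Bk y, ‖φ x‖ ≤ Φk) (hψ : ∀ y ∈ Yψ, ‖ψ y‖ ≤ Ψ) (hwk : ∀ y ∈ Yψ, |wk| * (Bk y).card ≤ 1)
    (hcard₁ : ∀ c, ((Yψ.filter (fun y => cube₁ y = c)).card : ℝ) ≤ rLen r e ^ d)
    -- Δ_{k,loc} summand (as in `abs_W1dltTot_le_scale`)
    (hg : 0 ≤ g) (hcA : 0 ≤ cA) (hcC : 0 ≤ cC) (hcΦd : 0 ≤ cΦd) (hcdG : 0 ≤ cdG) (hcw : 0 ≤ cw) (hA₀ : 0 ≤ A₀) (hCG0 : 0 ≤ CG)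
    (hVc : 0 ≤ Vc) (hγp : 0 ≤ γp) (hγ₁ : 0 ≤ γ₁) (hδG0 : 0 ≤ δG) (hδw0 : 0 ≤ δw) (hγ0 : ∀ m, 0 ≤ γr m)
    (hγd0 : ∀ m, 0 ≤ γd m) (hγ : ∀ m, γr m ≤ g * m.factorial * CG ^ m) (hγdle : ∀ m, γd m ≤ δw * m.factorial * CG ^ m)
    (hA₀e : A₀ ≤ cA * e * pLog p e) (hCGe : CG ≤ cC * e * pLog p e) (hreg : (2 * cA + cC) * e * pLog p e ≤ 1)
    (hγpg : γp ≤ g) (hγ₁g : γ₁ ≤ g) (hVcΦ : Vc ≤ Φd) (hΦd : e * Φd ≤ cΦd * pLog p e)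
    (hδG : δG ≤ cdG * e * Real.exp (-(cr * rLen r e)) * pLog p e) (hδw : δw ≤ cw * Real.exp (-(cr * rLen r e)))
    (hGs : ∀ z z', ∀ n : ℕ, ContDiff ℝ n (fun t => G t z z')) (hG's : ∀ z z', ∀ n : ℕ, ContDiff ℝ n (fun t => G' t z z'))
    (hUd : ∀ y z, z ∈ Bd y → ‖Ud y z‖ ≤ 1) (hAd : ∀ y z, z ∈ Bd y → |Ad y z| ≤ A₀) (hAd' : ∀ y z, z ∈ Bd y → |Ad' y z| ≤ δ')
    (hwd : ∀ x, |wd| * (Bd x).card ≤ 1) (hcol : ∀ z', ∑ y ∈ Ycol.filter (fun y => z' ∈ Bd y), |wd| * ‖v y‖ ≤ Vc)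
    (hGp : ∀ z, ∑ z', ‖Gp z z'‖ ≤ γp) (hG1 : ∀ z, ∑ z', ‖G 1 z z'‖ ≤ γ₁) (hGpd : ∀ z, ∑ z', ‖Gp z z' - G 1 z z'‖ ≤ δG)
    (hγG : ∀ t ∈ Set.Icc (0 : ℝ) 1, ∀ m ≤ nbar + 1, ∀ z, ∑ z', ‖iteratedDeriv m (fun s => G s z z') t‖ ≤ γr m)
    (hγdG : ∀ m ≤ nbar, ∀ z, ∑ z', ‖iteratedDeriv m (fun s => G s z z' - G' s z z') 0‖ ≤ γd m)
    (hv : ∀ x ∈ X, ‖v x‖ ≤ Φd)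
    -- 𝒫_{k,loc} summand (displayed, as in `abs_W1PTot_le_scale`)
    (hc₁ : 0 ≤ c₁) (hc₂ : 0 ≤ c₂) (hc₃ : 0 ≤ c₃) (hcP : 0 ≤ cP) (hPf : ∀ x ∈ X, ∀ n : ℕ, ContDiff ℝ n (Pfam x))
    (hPd : ∀ x ∈ X, ∀ t ∈ Set.Icc (0 : ℝ) 1,
      |iteratedDeriv (nbar + 1) (Pfam x) t| ≤ cP * (e * pLog p e) ^ (nbar + 1) * (pLog p e / e) ^ 2)
    (hP₁ : ∀ x ∈ X, |Pphys x - Pw x| ≤ c₁ * (e * Real.exp (-(cr * rLen r e))) * (pLog p e / e) ^ 2)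
    (hP₂ : ∀ x ∈ X, |Pw x - Pfam x 1| ≤ c₂ * (e * Real.exp (-(cr * rLen r e))) * (pLog p e / e) ^ 2)
    (hP₃ : ∀ x ∈ X, |δRP x| ≤ c₃ * (e * Real.exp (-(cr * rLen r e))) * (pLog p e / e) ^ 2)
    (hcard₀ : ∀ c, ((X.filter (fun x => cube₀ x = c)).card : ℝ) ≤ rLen r e ^ d)
    -- the threshold
    (hth : e ≤ threshold (kinTotConst κ cGk cΦk cΨ S₁ S₂ ca cΓ nbar + dltTotConst a g cA cC cΦd S₁ S₂ ca cΓ cdG cw nbar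
      + PTotConst c₁ c₂ c₃ cP) (kinLogPower p r d nbar) α') :
    Ineq5613 γ (W1tot κ Bk wk Uk Ak Ak' Pψ Pφ φ ψ a Bd wd Ud Ad Ad' Gp G G' v Ycol Pphys Pfam δRP nbar Yψ cube₁ X cube₀)
      e nbar α' := by
  have he1' : e ≤ 1 := le_one_of_le_exp_neg_one he1
  have hp1 : 1 ≤ pLog p e := by
    rw [pLog_eq_rpow he he1']
    exact Real.one_le_rpow (one_le_log_inv he he1) hp
  have hE0 : 0 ≤ Real.exp (-(cr * rLen r e)) := (Real.exp_pos _).le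
  have hEe : Real.exp (-(cr * rLen r e)) ≤ e ^ (nbar : ℝ) := exp_neg_mul_rLen_le_rpow hcr hr he he1' hbig
  refine ineq5613_three he he1 (kinTotConst_nonneg hcGk hcΦk hcΨ hS₁ hS₂ hca hcΓ nbar)
    (dltTotConst_nonneg (a := a) (cΦ := cΦd) hg hcA hcC hS₁ hS₂ hca hcΓ hcdG hcw nbar) (PTotConst_nonneg hc₁ hc₂ hc₃ hcP) hα hq
    (fun y hy => ?_) (fun x hx => ?_) (fun x hx => ?_) hcard₁ hcard₀ hth
  · exact BIJ88Eq5613KineticSources.abs_W1kinTot_le_scale he hp1 hcGk hcΦk hcΨ hS₁ hS₂ hca hcΓ hGk0 hΦk0 hδ0 hδ1 hδ'0 hδ'1 hE0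
      hEe hGk hΦk hΨ hδ hδ' (hUk y hy) (hAk y hy) (hPψ y hy) (fun x _ => hPφ x) (hAk' y hy) (hφ y hy) (hψ y hy) (hwk y hy)
  · exact abs_W1dltTot_le_scale he hp1 hg hcA hcC hcΦd hS₁ hS₂ hca hcΓ hcdG hcw hA₀ hCG0 hVc hγp hγ₁ hδ0 hδ1 hδ'0
      hδG0 hδw0 hE0 hEe hγ0 hγd0 hγ hγdle hA₀e hCGe hreg hγpg hγ₁g hVcΦ hΦd hδ hδ' hδG hδw hGs hG's hUd hAd hAd' hwd hcol hPφ
      hGp hG1 hGpd hγG hγdG (hv x hx)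
  · exact abs_W1PTot_le_scale he hp1 hc₁ hc₂ hc₃ hcP hEe (hPf x hx) (hPd x hx) (hP₁ x hx) (hP₂ x hx) (hP₃ x hx)

end Instance

end Literature.MathematicalPhysics.QuantumFieldTheory.BalabanImbrieJaffe1984to88.BIJ88Eq5613Total

end
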